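import Literature.AlgebraicGeometry.HodgeTheory.DivisorAlgebraPowers
import Literature.AlgebraicGeometry.HodgeTheory.DivisorLefschetzGroupLargest
import Literature.AlgebraicGeometry.HodgeTheory.DivisorAlgebraIndependentOfPolarization
import Literature.AlgebraicGeometry.HodgeTheory.WeilTypePeriodPoint
import Literature.AlgebraicGeometry.Milne1999.LefschetzCentraliserIsogeny
import Literature.AlgebraicGeometry.Milne1999.LefschetzCentraliserBiproducts
import Literature.AlgebraicGeometry.Milne1999.SpecialLefschetzGroupInvariantsCMSimple
import HarnessLib

/-!
# Moonen–Zarhin 1998 §1 up to isogeny, for `X ∼ ∏ᵢ Yᵢ^{mᵢ}` with all `mᵢ ≥ 2`, on the carrier: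
# `S_λ`, `B`, `G_div(X)` along isogenies; `B ⊗ ℂ = End⁰(X) ⊗ ℂ` and `G_div(X) = S(X)`;
# Lemma (1) «the center of `G_div(X)` is `U_{K_B}`» and Lemma (3) «`End(V_X)^{G_div(X)} = B`» as equalities; products

Layer `Literature/AlgebraicGeometry/HodgeTheory`; THEOREMS ONLY (no definition, no named fact; D-0026 net debt 0).
ONE file for the three rows g15-#3 (Chapter I), g15-#4 (Chapter II), g15-#5 (Chapter III) of the seat's generation 15,
sequel of rows g15-#1 `DivisorAlgebraSelfProduct` (`m = 2`) and g15-#2 `DivisorAlgebraPowers` (all `m ≥ 2`). Each chapter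
keeps its own introduction below.

## Chapter I (row g15-#3) — `S_λ`, `B` and `G_div(X)` «only depend on `X` up to isogeny»; `B ⊗ ℂ = End⁰(X) ⊗ ℂ` and `G_div(X) = S(X)` for EVERY `X` isogenous to a power `Y^m`, `m ≥ 2`, and EVERY polarization

Sequel of the seat's `DivisorAlgebraPowers` (`B(A^{a+2}) ⊗ ℂ = End⁰(A^{a+2}) ⊗ ℂ`,
`G_div(A^{a+2})(Σ prᵢ^* h) = S(A^{a+2})`, `= {u^{⊕(a+2)}}`), `DivisorLefschetzGroup` (`symmetricPullbackSpan`,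
`divisorLefschetzGroup`), `DivisorLefschetzGroupLargest` («`G_div(X)` does not depend on `λ`»:
`divisorLefschetzGroup_eq_of_mem_hodgeClassSpan`) and `DivisorAlgebraIndependentOfPolarization` («`B` does not
depend on `λ`»: `adjoin_symmetricPullbackSpan_eq_of_mem_hodgeClassSpan`); BY NAME the lane's
`Milne1999/LefschetzCentraliserIsogeny` (the transport `T ↦ f^* ∘ T ∘ (f^*)⁻¹` along an isogeny `f : X ⟶ X'`:
`isogenyPullbackOne`, `isogenyConj`, `C(X') ⊗ ℂ ≅ C(X) ⊗ ℂ`, `S(X')(h') ≅ S(X)(f^* h')`) and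
`Milne1999/SpecialLefschetzGroupOneEqUnitaryCentralizer` / `…InvariantsCMSimple` (the hypotheses on a
polarization class travel along pull-backs: `polarization_hypotheses_map`).

### The print (Chapter I)
B. J. J. Moonen, Yu. G. Zarhin, *Weil classes on abelian varieties*, J. reine angew. Math. **496** (1998)
83–92 = arXiv:alg-geom/9612017 [MoonenZarhin1998WeilClasses], §1 (held text `paper:arxiv-alg-geom_9612017`,
chunk p0002), VERBATIM: L45–46 «Since everything only depends on `X` up to isogeny, we may even assume that
`X = Y^m` for some `m ≥ 1`, where `Y` is simple.»; L83–85 «The group `G_div(X)` does not depend on the choice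
of `λ`. Without loss of generality we may therefore assume that there is a polarization `μ` on `Y` such that
`λ` is the product polarization `μ^m` on `X = Y^m`.»; L92–97 «… `G_div(X)` is the centralizer of `Δ` in
`SP(V_Y, φ_Y)`, embedded diagonally into `SP(V, φ)`. (In fact, if `m ≥ 2` … then we simply have `Δ = D`. …)»;
together with J. S. Milne, Duke Math. J. 96 (1999) §1 p. 643 «An isogeny `α : A → B` defines an isomorphism
`γ ↦ V(α) ∘ γ ∘ V(α)⁻¹ : C(A) → C(B)` of `k`-algebras with involution» and p. 644 «Clearly `S(A)` depends
only on the isogeny class of `A`».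

### What is proved (on the carrier `H¹(X(ℂ); ℂ)`; for an isogeny `f : X ⟶ X'` the class `h'` on `X'` travels as `f^* h'`) — Chapter I
* Part 1 — the three objects of Moonen–Zarhin §1 along an isogeny `f : X ⟶ X'` (the transport is
  `T ↦ f^* ∘ T ∘ (f^*)⁻¹ = (isogenyPullbackOne hf).conjAlgEquiv ℂ T` on endomorphisms and `isogenyConj hf`
  on automorphisms): `End⁰(X') ⊗ ℂ → End⁰(X) ⊗ ℂ` bijectively (`conjAlgEquiv_mem_span_pullbackOne_iff`,
  `exists_conjAlgEquiv_eq_of_mem_span_pullbackOne`; through the bicommutant `E'' = E` and the lane's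
  `C(X') ⊗ ℂ ≅ C(X) ⊗ ℂ`), Rosati-symmetry is preserved (`forall_polarizationPairingOne_conjAlgEquiv_comm_iff`),
  hence **`conjAlgEquiv_mem_symmetricPullbackSpan_iff`** (`S_λ(X') ⊗ ℂ ≅ S_{f^*λ}(X) ⊗ ℂ`),
  **`adjoin_symmetricPullbackSpan_map_conjAlgEquiv`** / `conjAlgEquiv_mem_adjoin_symmetricPullbackSpan_iff`
  (`B(X') ⊗ ℂ ≅ B(X) ⊗ ℂ`), **`isogenyConj_mem_divisorLefschetzGroup_iff`** / `divisorLefschetzGroup_map_isogenyConj`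
  (`G_div(X')(h')(ℂ) ≅ G_div(X)(f^*h')(ℂ)`), and the equality «`B ⊗ ℂ = End⁰ ⊗ ℂ`» travels
  (`mem_adjoin_symmetricPullbackSpan_of_mem_span_of_isIsogeny`, `forall_pullbackOne_mem_adjoin_symmetricPullbackSpan_of_isIsogeny`).
* Part 2 — the print's standing situation «`X` isogenous to `Y^m`», `m ≥ 2`, ANY polarization class: for a
  complex abelian variety `A` of positive dimension with `h ∈ B¹(A) ⊗ ℂ`, `Q_h` non-degenerate, `h^{dim A} ≠ 0`,
  every `X` with `AbelianVariety.IsIsogenous X (A.powSucc (a+1))` and every `h_X ∈ B¹(X) ⊗ ℂ` with `Q_{h_X}`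
  non-degenerate: **`pullbackOne_mem_adjoin_symmetricPullbackSpan_of_isIsogenous_powSucc`** and
  **`adjoin_symmetricPullbackSpan_eq_span_of_isIsogenous_powSucc`** (`B(X) ⊗ ℂ = End⁰(X) ⊗ ℂ`),
  **`divisorLefschetzGroup_eq_unitaryCentralizerGroup_of_isIsogenous_powSucc`** (`G_div(X)(h_X) = S(X)(h_X)`),
  and «embedded diagonally» through the isogeny: **`mem_divisorLefschetzGroup_iff_exists_isogenyConj_diagPow`**
  (`G_div(X)(f^* Σ prᵢ^* h)(ℂ) = {f^* ∘ u^{⊕(a+2)} ∘ (f^*)⁻¹ : u ∈ S(A)(h)(ℂ)}`).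

Simplicity of `Y` is not used. NOT here: `m = 1`; Table 1; `G_div` as a `ℚ`-group; nothing about the Hodge
conjecture.

## Chapter II (row g15-#4) — Lemma (1) «the center of `G_div(X)` is `U_{K_B}`» and Lemma (3) «`End(V_X)^{G_div(X)} = B`», tensored with `ℂ`, for every `X` isogenous to a power `Y^m`, `m ≥ 2` — as EQUALITIES

Sequel of the seat's `DivisorLefschetzGroup` (Part 3 there proves the two INCLUSIONS that hold for every
`X`: `End(V_X)^{G_div(X)(ℂ)} ⊆ End⁰(X) ⊗ ℂ` (`mem_span_pullbackOne_of_forall_mem_divisorLefschetzGroup_comm`, through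
`Hg(X)(ℂ)|_{H¹} ≤ G_div(X)(ℂ)` and Deligne's `End(V)^{Hg} = End⁰ ⊗ ℂ`), `U_{K_B}(ℂ) ⊆ Z(G_div(X)(ℂ))`
(`mem_center_divisorLefschetzGroup_of_coe_mem_adjoin`) and `Z(G_div(X)(ℂ)) ⊆ End⁰(X) ⊗ ℂ`
(`coe_mem_span_pullbackOne_of_mem_center_divisorLefschetzGroup`), and records that the equalities «need the double
commutant theorem for `B ⊗ ℂ`»), of `DivisorAlgebraPowers` and of Chapter I (for `X` isogenous to `A^{a+2}` and any polarization class: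
`B(X) ⊗ ℂ = End⁰(X) ⊗ ℂ`, `pullbackOne_mem_adjoin_symmetricPullbackSpan_of_isIsogenous_powSucc`). With
`B ⊗ ℂ = End⁰(X) ⊗ ℂ` the missing inclusions close WITHOUT a double commutant theorem: this chapter proves the two
lemmas as equalities in that case.

### The print (Chapter II)
B. J. J. Moonen, Yu. G. Zarhin, *Weil classes on abelian varieties*, J. reine angew. Math. **496** (1998)
83–92 = arXiv:alg-geom/9612017 [MoonenZarhin1998WeilClasses], §1 Lemma (held text `paper:arxiv-alg-geom_9612017`,
chunk p0002 L121–127, chunk p0003 L1–13), VERBATIM: «Lemma. (1) The center of `G_div(X)` is the group `U_{K_B}`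
given by `U_{K_B}(R) = {a ∈ (K_B ⊗_ℚ R)^* | a a† = 1}`. […] (3) `End(V_X)^{G_div(X)} = B`; […] Proof. To prove
this, we can first extend scalars to `ℂ`, and (1) and (2) then readily follow from Table 2.» (`K_B` = the centre
of `B`; `X = Y^m`; for `m ≥ 2`, `B = Mat_m(D) = End⁰(X)`, chunk p0002 L96–97 and chunk p0003.)

### What is proved (on the carrier `H¹(X(ℂ); ℂ)`, scalars extended to `ℂ` as in the printed proof) — Chapter II
* Part 1 — the mechanism, for any complex abelian variety `X` and class `h_X ∈ B¹(X) ⊗ ℂ` such that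
  `B(X)(h_X) ⊗ ℂ = End⁰(X) ⊗ ℂ` (hypothesis `hB`: every pull-back `ψ^*` lies in the subalgebra generated by
  `S_λ ⊗ ℂ`): **`forall_mem_divisorLefschetzGroup_comm_iff_mem_adjoin`** (Lemma (3), first clause, `⊗ ℂ`: an
  endomorphism commutes with `G_div(X)(ℂ)` iff it lies in `B ⊗ ℂ`), **`mem_center_divisorLefschetzGroup_iff_coe_mem_adjoin`**
  / `…_iff_coe_mem_span` (Lemma (1): an element of `G_div(X)(ℂ)` is central iff it lies in `B ⊗ ℂ` iff it lies in
  `End⁰(X) ⊗ ℂ`), **`mem_divisorLefschetzGroup_and_forall_comm_iff`** (Lemma (1) as the print's set: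
  `Z(G_div(X)(ℂ)) = {a ∈ Z(B ⊗ ℂ) : a preserves Q}`), and the print's spelling «`a a† = 1`» of `Q`-preservation
  for an element with a Rosati adjoint (`forall_polarizationPairingOne_map_map_eq_iff_adjoint_mul_eq_one`,
  `…_iff_mul_adjoint_eq_one`).
* Part 2 — the print's situation `X ∼ Y^m`, `m ≥ 2`: for `A` of positive dimension with `h ∈ B¹(A) ⊗ ℂ`, `Q_h`
  non-degenerate, `h^{dim A} ≠ 0`, every `X` with `AbelianVariety.IsIsogenous X (A.powSucc (a+1))` and every
  `h_X ∈ B¹(X) ⊗ ℂ` with `Q_{h_X}` non-degenerate, the hypothesis `hB` holds (Chapter I), whence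
  **`forall_mem_divisorLefschetzGroup_comm_iff_mem_adjoin_of_isIsogenous_powSucc`** («`End(V_X)^{G_div(X)} = B`» ⊗ ℂ),
  **`mem_center_divisorLefschetzGroup_iff_coe_mem_adjoin_of_isIsogenous_powSucc`** and
  **`mem_divisorLefschetzGroup_and_forall_comm_iff_of_isIsogenous_powSucc`** («the center of `G_div(X)` is `U_{K_B}`»,
  `ℂ`-points); and the same for the powers `A^{a+2}` themselves with the product class (`…_powSucc`).

The route differs from the print's (which reads (1) off Table 2 after the classification): here (3) ⊆ comes from
Deligne's `End(V)^{Hg} = End⁰ ⊗ ℂ` (already in the seat's `DivisorLefschetzGroup`) and `B ⊗ ℂ = End⁰ ⊗ ℂ` for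
`m ≥ 2`. NOT here: `m = 1` (where `B ⊊ End⁰(X)` can happen and the double commutant is needed); the torus
structure / rank `e_0` of `U_{K_B}`; (2) connectedness; `G_div` as a `ℚ`-group.

## Chapter III (row g15-#5) — «`Δ = D`» is stable under products: `B(X × A) ⊗ ℂ = End⁰(X × A) ⊗ ℂ` and `G_div(X × A) = S(X × A)` as soon as both factors satisfy `B ⊗ ℂ = End⁰ ⊗ ℂ`; finite products `X ∼ ∏ᵢ Yᵢ^{mᵢ}`, `mᵢ ≥ 2`

Sequel of Chapter II (Lemma (1)/(3) as equalities from the hypothesis «every `ψ^*` lies in `B ⊗ ℂ`»), of the seat's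
`DivisorAlgebraPowers` (Part 1 there: the block embedding `S ↦ S ⊕ 0` of the FIRST
factor, `prodBlockDiag_zero_mem_adjoin_symmetricPullbackSpan_prod`; Part 2: the off-diagonal corners
`e T (1 − e)`, `(1 − e) T e` of a symmetric idempotent lie in `B ⊗ ℂ`) and of Chapter I (`X ∼ Y^m`,
`m ≥ 2` ⟹ `B(X) ⊗ ℂ = End⁰(X) ⊗ ℂ` for every polarization class). This chapter adds the block embedding
`T ↦ 0 ⊕ T` of the SECOND factor and assembles: the (2,2) corner `(1 − e) ψ^* (1 − e) = 0 ⊕ (ι_A ≫ ψ ≫ pr_A)^*`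
needs no retraction any more, so the print's matrix-unit mechanism («`B = Mat_m(D)`»: diagonal blocks from the
factors, off-diagonal blocks from the hermitian elements `E_{ij}(d) + E_{ji}(d^†)`) runs for an ARBITRARY product
`X × A` of two abelian varieties each of which has `B ⊗ ℂ = End⁰ ⊗ ℂ`.

### The print (Chapter III)
B. J. J. Moonen, Yu. G. Zarhin, *Weil classes on abelian varieties*, J. reine angew. Math. **496** (1998)
83–92 = arXiv:alg-geom/9612017 [MoonenZarhin1998WeilClasses], §1 (held text `paper:arxiv-alg-geom_9612017`):
chunk p0001 (end)–p0002 L1–5 «Up to isogeny we can decompose `X` as `X ∼ Y₁^{m₁} × ⋯ × Y_k^{m_k}` […] the action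
of `F` on `X` is the “diagonal action” w.r.t. the decomposition»; chunk p0002 L56–58 «We define the algebra
`B ⊆ End⁰(X)` as the `ℚ`-subalgebra generated by `S_λ`»; L66–71 «`G_div(X) := Gl_B(V) ∩ SP(V, φ)`»; L87–90 «With
`End⁰(X) = Mat_m(D)`, the Rosati involutions `∗` and `†` are related by `α† = (α*_{ji})`»; L96–97 «if `m ≥ 2` or
if `X` is of type 1 or 2, then we simply have `Δ = D`»; chunk p0003 «We have `B = Mat_m(D)`»; with J. S. Milne,
Duke Math. J. 96 (1999) §1 p. 643 «`V(A₁ × A₂) = V(A₁) ⊕ V(A₂)` […] the involution `D` defines on `C(A)` is the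
restriction of the product of the involutions on the `C(Aᵢ)` defined by the `Dᵢ`».

### What is proved (on the carrier; `H = pr_X^* h_X + pr_A^* h` the product class, `0 < dim X`, `0 < dim A`) — Chapter III
* Part 1 — the second factor: `prodBlockDiag_zero_one` (`0 ⊕ 1 = (pr_A ≫ ι_A)^*`), `prodBlockDiag_zero_left_mul`,
  `prodBlockDiag_zero_left_mem_span`, `polarizationPairingOne_prod_map_snd_left/right` (the `A`–`A` block of `Q_H`),
  `prodBlockDiag_zero_left_comm_polarizationPairingOne`, `prodBlockDiag_zero_left_mem_symmetricPullbackSpan_prod`,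
  `projSnd_mem_symmetricPullbackSpan_prod`, **`prodBlockDiag_zero_left_mem_adjoin_symmetricPullbackSpan_prod`**
  (`0 ⊕ B(A) ⊗ ℂ ⊆ B(X × A) ⊗ ℂ`).
* Part 2 — **`pullbackOne_prod_mem_adjoin_symmetricPullbackSpan_of_forall`**: if every `φ^*`, `φ ∈ End(X)`, lies
  in `B(X)(h_X) ⊗ ℂ` and every `φ^*`, `φ ∈ End(A)`, lies in `B(A)(h) ⊗ ℂ` (`h_X`, `h` in `B¹ ⊗ ℂ` with non-degenerate
  pairings and non-zero top powers), then every `ψ^*`, `ψ ∈ End(X × A)`, lies in `B(X × A)(H) ⊗ ℂ`;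
  **`adjoin_symmetricPullbackSpan_prod_eq_span_of_forall`** (`B(X × A) ⊗ ℂ = End⁰(X × A) ⊗ ℂ`),
  **`divisorLefschetzGroup_prod_eq_unitaryCentralizerGroup_of_forall`** (`G_div(X × A)(H) = S(X × A)(H)`) and, by
  the independence of the polarization, **`…_of_forall'`** for EVERY class `H' ∈ B¹(X × A) ⊗ ℂ` with `Q_{H'}`
  non-degenerate.
* Part 3 — the print's decomposition with all multiplicities `≥ 2`, two isotypic blocks:
  **`divisorLefschetzGroup_prod_eq_unitaryCentralizerGroup_of_isIsogenous_powSucc`** — for `X ∼ A₁^{a+2}`,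
  `X' ∼ A₂^{b+2}` and every admissible class `H'` on `X × X'`: `G_div(X × X')(H') = S(X × X')(H')`
  (no hypothesis relating `A₁` and `A₂`).

* Part 4 — any number of blocks: **`pullbackOne_biproduct_mem_adjoin_symmetricPullbackSpan`** (a finite biproduct
  `⨁ᵢ Aᵢ` with Milne's product class `Σᵢ πᵢ^* hᵢ` — the lane's `Milne1999/LefschetzCentraliserBiproducts` — has
  «`Δ = D`» when its factors do; induction along `⨁_{Fin (n+1)} A ≅ A 0 × ⨁ (A ∘ succ)`),
  `divisorLefschetzGroup_biproduct_eq_unitaryCentralizerGroup`,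
  `pullbackOne_mem_adjoin_symmetricPullbackSpan_of_isIsogenous_biproduct` (up to isogeny, any polarization class), and
  THE GENERAL STATEMENT **`divisorLefschetzGroup_eq_unitaryCentralizerGroup_of_isIsogenous_biproduct_powSucc`**: for
  `X ∼ ⨁ᵢ Yᵢ^{aᵢ+2}` (all multiplicities `≥ 2`, no hypothesis relating the `Yᵢ`) and every admissible class `h_X`,
  `G_div(X)(h_X) = S(X)(h_X)`; `adjoin_symmetricPullbackSpan_eq_span_of_isIsogenous_biproduct_powSucc` (`B(X) ⊗ ℂ = End⁰(X) ⊗ ℂ`), and Lemma (3) clause 1 / Lemma (1) for these `X`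
  (`forall_mem_divisorLefschetzGroup_comm_iff_mem_adjoin_of_isIsogenous_biproduct_powSucc`,
  `mem_center_divisorLefschetzGroup_iff_coe_mem_adjoin_of_isIsogenous_biproduct_powSucc`).

NOT here: factors with `m = 1` of type 3/4 (where `B ⊊ End⁰`).

## References

* [MoonenZarhin1998WeilClasses] B. J. J. Moonen, Yu. G. Zarhin, *Weil classes on abelian varieties*, J. reine angew.
  Math. 496 (1998) 83–92 = arXiv:alg-geom/9612017, §1: chunk p0001 (end)–p0002 L1–5 (decomposition up to isogeny,
  diagonal action), p0002 L45–46 («everything only depends on `X` up to isogeny»), L53–61 (`S_λ`, `B`), L66–71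
  (`G_div(X) := Gl_B(V) ∩ SP(V, φ)`), L83–97 («does not depend on `λ`», «`Δ = D`», «embedded diagonally»), L121–127 and
  chunk p0003 L1–13 (Lemma (1), (3) and proof), chunk p0003 («`B = Mat_m(D)`»).
* [Milne1999LefschetzClasses] J. S. Milne, *Lefschetz classes on abelian varieties*, Duke Math. J. 96 (1999),
  Notations p. 641, §1 pp. 642–644 (isogeny invariance of `C(A)` and `S(A)`, `V(A₁ × A₂) = V(A₁) ⊕ V(A₂)`, the product
  involution).
* [Deligne1982HodgeCycles] P. Deligne, *Hodge cycles on abelian varieties*, LNM 900 (1982), I §3 Prop. 3.4.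
* [MumfordAV1970] D. Mumford, *Abelian Varieties*, §19 Remark p. 169 (quasi-inverse of an isogeny), §21.
* [vanGeemen1994HodgeAV] B. van Geemen, LNM 1594 (1994), §3.6 (`φ^* : H¹(X, ℚ) ≅ H¹(Y, ℚ)` for an isogeny).
* [LangeBirkenhake1992] H. Lange, Ch. Birkenhake, *Complex Abelian Varieties*, §5.3 (product polarizations).
* [HatcherAT2002] A. Hatcher, *Algebraic Topology*, §3.2 Prop. 3.10 (naturality of the cup product), Thm. 3.11
  (graded commutativity), Thm. 3.16 (Künneth).

## Provenance

Lane `lit-hodgefound` (Track 2, Layer A), prover seat `lit-hodgefound-p21` (generation 15), rows g15-#3, g15-#4, g15-#5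
in one file (the Chapter-I-only filing p372354 of this path was withdrawn unverified — farm-deferred on the
`DivisorAlgebraPowers` olean — and replaced by this text).
-/

noncomputable section

open CategoryTheory
open Literature.AlgebraicTopology.SingularHomology
open Literature.AlgebraicGeometry.Motives
open Literature.AlgebraicGeometry.VanGeemen1994 (pullbackOne hodgeClassSpan)
open Literature.AlgebraicGeometry.Milne1999
open Literature.Geometry.Kaehler (lefschetzPow)

namespace Literature.AlgebraicGeometry.HodgeTheory

/-! # Chapter I (row g15-#3). `S_λ`, `B`, `G_div` up to isogeny; `X ∼ Y^m`, `m ≥ 2` -/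

/-! ## Chapter I, Part 1. `End⁰ ⊗ ℂ`, `S_λ ⊗ ℂ`, `B ⊗ ℂ`, `G_div` along an isogeny `f : X ⟶ X'` -/

section Transport

variable {X X' : AbelianVariety ℂ} {f : X ⟶ X'}

/-- **The characteristic property of the transport on endomorphisms**: `(f^* ∘ T ∘ (f^*)⁻¹)(f^* y) = f^* (T y)`
(Milne: `γ ↦ V(α) ∘ γ ∘ V(α)⁻¹`, read on `H¹`). [cite: Milne1999LefschetzClasses, §1 p. 643] -/
theorem isogeny_conjAlgEquiv_apply_map (hf : AbelianVariety.IsIsogeny f) (T : Module.End ℂ (complexBetti X'.X 1))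
    (y : complexBetti X'.X 1) :
    (isogenyPullbackOne hf).conjAlgEquiv ℂ T (complexBetti.map f.hom.hom.hom 1 y) =
      complexBetti.map f.hom.hom.hom 1 (T y) := by
  simp only [LinearEquiv.conjAlgEquiv_apply, LinearMap.comp_apply, LinearEquiv.coe_toLinearMap,
    isogenyPullbackOne_apply]
  rw [isogenyPullbackOne_symm_map]

/-- **`End⁰(X') ⊗ ℂ ≅ End⁰(X) ⊗ ℂ` along an isogeny** `f : X ⟶ X'`: `f^* ∘ T ∘ (f^*)⁻¹` is a `ℂ`-combination of
pull-backs `ψ^*`, `ψ ∈ End(X)`, iff `T` is a `ℂ`-combination of pull-backs `ψ'^*`, `ψ' ∈ End(X')` — through the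
bicommutant (`End⁰ ⊗ ℂ = E'' = (C ⊗ ℂ)'`, Milne Remark 1.2, the lane's `mem_bicommutant_iff_mem_span`) and the
lane's `C(X') ⊗ ℂ ≅ C(X) ⊗ ℂ` («an isogeny defines an isomorphism `C(A) → C(B)`»). «Since everything only depends
on `X` up to isogeny …». [cite: MoonenZarhin1998WeilClasses, §1 (chunk p0002 L45–46)]
[cite: Milne1999LefschetzClasses, §1 p. 643 and Remark 1.2] -/
theorem conjAlgEquiv_mem_span_pullbackOne_iff (hf : AbelianVariety.IsIsogeny f)
    {T : Module.End ℂ (complexBetti X'.X 1)} :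
    (isogenyPullbackOne hf).conjAlgEquiv ℂ T ∈ Submodule.span ℂ (Set.range fun ψ : X ⟶ X ↦ pullbackOne X ψ) ↔
      T ∈ Submodule.span ℂ (Set.range fun ψ' : X' ⟶ X' ↦ pullbackOne X' ψ') := by
  rw [← mem_bicommutant_iff_mem_span, ← mem_bicommutant_iff_mem_span, Subalgebra.mem_centralizer_iff,
    Subalgebra.mem_centralizer_iff]
  constructor
  · intro H c' hc'
    have e := H _ (conjAlgEquiv_mem_centralizerAlgebra hf hc')
    rw [← map_mul, ← map_mul] at e
    exact ((isogenyPullbackOne hf).conjAlgEquiv ℂ).injective e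
  · intro H c hc
    have hc₀ : c ∈ (centralizerAlgebra X').map
        ((isogenyPullbackOne hf).conjAlgEquiv ℂ :
          Module.End ℂ (complexBetti X'.X 1) →ₐ[ℂ] Module.End ℂ (complexBetti X.X 1)) := by
      rw [centralizerAlgebra_map_conjAlgEquiv hf]
      exact hc
    obtain ⟨c', hc', rfl⟩ := Subalgebra.mem_map.1 hc₀
    rw [AlgEquiv.toAlgHom_apply, ← map_mul, ← map_mul, H c' hc']

/-- **The transport is ONTO `End⁰(X) ⊗ ℂ`**: every `ℂ`-combination of pull-backs on `X` is `f^* ∘ T ∘ (f^*)⁻¹`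
for a `ℂ`-combination `T` of pull-backs on `X'`. [cite: MoonenZarhin1998WeilClasses, §1 (chunk p0002 L45–46)]
[cite: Milne1999LefschetzClasses, §1 p. 643] -/
theorem exists_conjAlgEquiv_eq_of_mem_span_pullbackOne (hf : AbelianVariety.IsIsogeny f)
    {S : Module.End ℂ (complexBetti X.X 1)}
    (hS : S ∈ Submodule.span ℂ (Set.range fun ψ : X ⟶ X ↦ pullbackOne X ψ)) :
    ∃ T ∈ Submodule.span ℂ (Set.range fun ψ' : X' ⟶ X' ↦ pullbackOne X' ψ'),
      (isogenyPullbackOne hf).conjAlgEquiv ℂ T = S := by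
  refine ⟨((isogenyPullbackOne hf).conjAlgEquiv ℂ).symm S, ?_, AlgEquiv.apply_symm_apply _ _⟩
  rw [← conjAlgEquiv_mem_span_pullbackOne_iff hf, AlgEquiv.apply_symm_apply]
  exact hS

/-- **Rosati-symmetry travels along an isogeny** (any exponent `j`): `f^* ∘ T ∘ (f^*)⁻¹` is
`Q_{f^*h', j}`-self-adjoint on `H¹(X)` iff `T` is `Q_{h', j}`-self-adjoint on `H¹(X')` — naturality
`f^* Q_{h',j}(x, y) = Q_{f^*h',j}(f^* x, f^* y)` and injectivity of `f^*` (Milne: the isomorphism `C(A) → C(B)` is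
one «of `k`-algebras with involution»). [cite: Milne1999LefschetzClasses, §1 p. 643]
[cite: HatcherAT2002, §3.2 Prop. 3.10] -/
theorem forall_polarizationPairingOne_conjAlgEquiv_comm_iff (hf : AbelianVariety.IsIsogeny f)
    (h' : complexBetti X'.X 2) (j : ℕ) {T : Module.End ℂ (complexBetti X'.X 1)} :
    (∀ x y : complexBetti X.X 1,
        polarizationPairingOne X.X (complexBetti.map f.hom.hom.hom 2 h') j
            ((isogenyPullbackOne hf).conjAlgEquiv ℂ T x) y =
          polarizationPairingOne X.X (complexBetti.map f.hom.hom.hom 2 h') j x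
            ((isogenyPullbackOne hf).conjAlgEquiv ℂ T y)) ↔
      ∀ x y : complexBetti X'.X 1,
        polarizationPairingOne X'.X h' j (T x) y = polarizationPairingOne X'.X h' j x (T y) := by
  constructor
  · intro H x y
    apply (complexBetti_map_bijective_of_isIsogeny hf (2 + 2 * j)).1
    have e := H (complexBetti.map f.hom.hom.hom 1 x) (complexBetti.map f.hom.hom.hom 1 y)
    rw [isogeny_conjAlgEquiv_apply_map, isogeny_conjAlgEquiv_apply_map, ← map_polarizationPairingOne,
      ← map_polarizationPairingOne] at e
    exact e
  · intro H x y
    obtain ⟨x, rfl⟩ := (isogenyPullbackOne hf).surjective x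
    obtain ⟨y, rfl⟩ := (isogenyPullbackOne hf).surjective y
    simp only [isogenyPullbackOne_apply]
    rw [isogeny_conjAlgEquiv_apply_map, isogeny_conjAlgEquiv_apply_map, ← map_polarizationPairingOne,
      ← map_polarizationPairingOne, H]

/-- **`S_λ(X') ⊗ ℂ ≅ S_{f^*λ}(X) ⊗ ℂ` along an isogeny** `f : X ⟶ X'`: `f^* ∘ T ∘ (f^*)⁻¹ ∈ S_{f^*h'}(X) ⊗ ℂ`
iff `T ∈ S_{h'}(X') ⊗ ℂ` (Moonen–Zarhin's set `S_λ` of `†`-symmetric elements, tensored with `ℂ`; `dim X = dim X'`).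
[cite: MoonenZarhin1998WeilClasses, §1 (chunk p0002 L45–46, L53–58)] [cite: Milne1999LefschetzClasses, §1 p. 643] -/
theorem conjAlgEquiv_mem_symmetricPullbackSpan_iff (hf : AbelianVariety.IsIsogeny f) (h' : complexBetti X'.X 2)
    {T : Module.End ℂ (complexBetti X'.X 1)} :
    (isogenyPullbackOne hf).conjAlgEquiv ℂ T ∈ symmetricPullbackSpan X (complexBetti.map f.hom.hom.hom 2 h') ↔
      T ∈ symmetricPullbackSpan X' h' := by
  rw [mem_symmetricPullbackSpan_iff, mem_symmetricPullbackSpan_iff, conjAlgEquiv_mem_span_pullbackOne_iff hf,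
    AbelianVariety.dim_eq_of_isIsogeny hf, forall_polarizationPairingOne_conjAlgEquiv_comm_iff hf h']

/-- **The transport is ONTO `S_{f^*λ}(X) ⊗ ℂ`.** [cite: MoonenZarhin1998WeilClasses, §1 (chunk p0002 L45–46, L53–58)]
[cite: Milne1999LefschetzClasses, §1 p. 643] -/
theorem exists_conjAlgEquiv_eq_of_mem_symmetricPullbackSpan (hf : AbelianVariety.IsIsogeny f)
    (h' : complexBetti X'.X 2) {S : Module.End ℂ (complexBetti X.X 1)}
    (hS : S ∈ symmetricPullbackSpan X (complexBetti.map f.hom.hom.hom 2 h')) :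
    ∃ T ∈ symmetricPullbackSpan X' h', (isogenyPullbackOne hf).conjAlgEquiv ℂ T = S := by
  refine ⟨((isogenyPullbackOne hf).conjAlgEquiv ℂ).symm S, ?_, AlgEquiv.apply_symm_apply _ _⟩
  rw [← conjAlgEquiv_mem_symmetricPullbackSpan_iff hf h', AlgEquiv.apply_symm_apply]
  exact hS

/-- **`B(X') ⊗ ℂ ≅ B(X) ⊗ ℂ` along an isogeny**: the subalgebra generated by `S_{h'}(X') ⊗ ℂ` is carried ONTO the
subalgebra generated by `S_{f^*h'}(X) ⊗ ℂ` by the algebra isomorphism `T ↦ f^* ∘ T ∘ (f^*)⁻¹` («the algebra `B`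
… the `ℚ`-subalgebra generated by `S_λ`»). [cite: MoonenZarhin1998WeilClasses, §1 (chunk p0002 L45–46, L56–58)]
[cite: Milne1999LefschetzClasses, §1 p. 643] -/
theorem adjoin_symmetricPullbackSpan_map_conjAlgEquiv (hf : AbelianVariety.IsIsogeny f) (h' : complexBetti X'.X 2) :
    (Algebra.adjoin ℂ (symmetricPullbackSpan X' h' : Set (Module.End ℂ (complexBetti X'.X 1)))).map
        ((isogenyPullbackOne hf).conjAlgEquiv ℂ :
          Module.End ℂ (complexBetti X'.X 1) →ₐ[ℂ] Module.End ℂ (complexBetti X.X 1)) =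
      Algebra.adjoin ℂ (symmetricPullbackSpan X (complexBetti.map f.hom.hom.hom 2 h') :
        Set (Module.End ℂ (complexBetti X.X 1))) := by
  rw [AlgHom.map_adjoin]
  congr 1
  ext S
  simp only [Set.mem_image, SetLike.mem_coe]
  constructor
  · rintro ⟨T, hT, rfl⟩
    exact (conjAlgEquiv_mem_symmetricPullbackSpan_iff hf h').2 hT
  · intro hS
    exact exists_conjAlgEquiv_eq_of_mem_symmetricPullbackSpan hf h' hS

/-- **`f^* ∘ T ∘ (f^*)⁻¹ ∈ B(X) ⊗ ℂ ⟺ T ∈ B(X') ⊗ ℂ`** (for the classes `f^* h'`, `h'`).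
[cite: MoonenZarhin1998WeilClasses, §1 (chunk p0002 L45–46, L56–58)] [cite: Milne1999LefschetzClasses, §1 p. 643] -/
theorem conjAlgEquiv_mem_adjoin_symmetricPullbackSpan_iff (hf : AbelianVariety.IsIsogeny f)
    (h' : complexBetti X'.X 2) {T : Module.End ℂ (complexBetti X'.X 1)} :
    (isogenyPullbackOne hf).conjAlgEquiv ℂ T ∈ Algebra.adjoin ℂ
        (symmetricPullbackSpan X (complexBetti.map f.hom.hom.hom 2 h') : Set (Module.End ℂ (complexBetti X.X 1))) ↔
      T ∈ Algebra.adjoin ℂ (symmetricPullbackSpan X' h' : Set (Module.End ℂ (complexBetti X'.X 1))) := by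
  rw [← adjoin_symmetricPullbackSpan_map_conjAlgEquiv hf h', Subalgebra.mem_map]
  constructor
  · rintro ⟨T', hT', e⟩
    rw [AlgEquiv.toAlgHom_apply] at e
    rwa [← ((isogenyPullbackOne hf).conjAlgEquiv ℂ).injective e]
  · intro hT
    exact ⟨T, hT, rfl⟩

/-- **`G_div(X')(h')(ℂ) ≅ G_div(X)(f^* h')(ℂ)` along an isogeny** `f : X ⟶ X'`: `f^* ∘ U ∘ (f^*)⁻¹` commutes with
`S_{f^*h'}(X) ⊗ ℂ` and preserves `Q_{f^*h'}` iff `U` commutes with `S_{h'}(X') ⊗ ℂ` and preserves `Q_{h'}`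
(«`G_div(X) := Gl_B(V) ∩ SP(V, φ)`»; «everything only depends on `X` up to isogeny»).
[cite: MoonenZarhin1998WeilClasses, §1 (chunk p0002 L45–46, L66–71)] [cite: Milne1999LefschetzClasses, §1 pp. 643–644] -/
theorem isogenyConj_mem_divisorLefschetzGroup_iff (hf : AbelianVariety.IsIsogeny f) (h' : complexBetti X'.X 2)
    {U : complexBetti X'.X 1 ≃ₗ[ℂ] complexBetti X'.X 1} :
    isogenyConj hf U ∈ divisorLefschetzGroup X (complexBetti.map f.hom.hom.hom 2 h') ↔
      U ∈ divisorLefschetzGroup X' h' := by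
  rw [mem_divisorLefschetzGroup_iff, mem_divisorLefschetzGroup_iff, AbelianVariety.dim_eq_of_isIsogeny hf]
  refine and_congr ⟨fun H T hT y ↦ ?_, fun H S hS x ↦ ?_⟩ ?_
  · have e := H _ ((conjAlgEquiv_mem_symmetricPullbackSpan_iff hf h').2 hT) (complexBetti.map f.hom.hom.hom 1 y)
    rw [isogeny_conjAlgEquiv_apply_map, isogenyConj_apply_map, isogenyConj_apply_map,
      isogeny_conjAlgEquiv_apply_map] at e
    exact (complexBetti_map_bijective_of_isIsogeny hf 1).1 e
  · obtain ⟨T, hT, rfl⟩ := exists_conjAlgEquiv_eq_of_mem_symmetricPullbackSpan hf h' hS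
    obtain ⟨y, rfl⟩ := (isogenyPullbackOne hf).surjective x
    rw [isogenyPullbackOne_apply, isogeny_conjAlgEquiv_apply_map, isogenyConj_apply_map, isogenyConj_apply_map,
      isogeny_conjAlgEquiv_apply_map, H T hT y]
  · have e := forall_polarizationPairingOne_isogenyConj_iff (u := U) hf h' (X'.dim - 1) 1
    simp only [one_smul] at e
    exact e

/-- **`G_div(X')(h')(ℂ)` is carried ONTO `G_div(X)(f^* h')(ℂ)`** by `isogenyConj hf`.
[cite: MoonenZarhin1998WeilClasses, §1 (chunk p0002 L45–46, L66–71)] [cite: Milne1999LefschetzClasses, §1 pp. 643–644] -/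
theorem divisorLefschetzGroup_map_isogenyConj (hf : AbelianVariety.IsIsogeny f) (h' : complexBetti X'.X 2) :
    (divisorLefschetzGroup X' h').map (isogenyConj hf : (complexBetti X'.X 1 ≃ₗ[ℂ] complexBetti X'.X 1) →*
        (complexBetti X.X 1 ≃ₗ[ℂ] complexBetti X.X 1)) =
      divisorLefschetzGroup X (complexBetti.map f.hom.hom.hom 2 h') := by
  ext V
  rw [Subgroup.mem_map]
  constructor
  · rintro ⟨U, hU, rfl⟩
    exact (isogenyConj_mem_divisorLefschetzGroup_iff hf h').2 hU
  · intro hV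
    refine ⟨(isogenyConj hf).symm V, ?_, MulEquiv.apply_symm_apply _ _⟩
    rw [← isogenyConj_mem_divisorLefschetzGroup_iff hf h', MulEquiv.apply_symm_apply]
    exact hV

/-- **«`B = Mat_m(D)`» (`B ⊗ ℂ = End⁰ ⊗ ℂ`) travels along an isogeny**: if every pull-back `ψ'^*`,
`ψ' ∈ End(X')`, lies in `B(X')(h') ⊗ ℂ`, then every `ℂ`-combination of pull-backs on `X` lies in
`B(X)(f^* h') ⊗ ℂ` (it is `f^* ∘ T ∘ (f^*)⁻¹` with `T ∈ End⁰(X') ⊗ ℂ ⊆ B(X') ⊗ ℂ`).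
[cite: MoonenZarhin1998WeilClasses, §1 (chunk p0002 L45–46; chunk p0003 «B = Mat_m(D)»)] [cite: Milne1999LefschetzClasses, §1 p. 643] -/
theorem mem_adjoin_symmetricPullbackSpan_of_mem_span_of_isIsogeny (hf : AbelianVariety.IsIsogeny f)
    (h' : complexBetti X'.X 2)
    (hB : ∀ ψ' : X' ⟶ X', pullbackOne X' ψ' ∈
      Algebra.adjoin ℂ (symmetricPullbackSpan X' h' : Set (Module.End ℂ (complexBetti X'.X 1))))
    {S : Module.End ℂ (complexBetti X.X 1)}
    (hS : S ∈ Submodule.span ℂ (Set.range fun ψ : X ⟶ X ↦ pullbackOne X ψ)) :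
    S ∈ Algebra.adjoin ℂ
      (symmetricPullbackSpan X (complexBetti.map f.hom.hom.hom 2 h') : Set (Module.End ℂ (complexBetti X.X 1))) := by
  obtain ⟨T, hT, rfl⟩ := exists_conjAlgEquiv_eq_of_mem_span_pullbackOne hf hS
  rw [conjAlgEquiv_mem_adjoin_symmetricPullbackSpan_iff hf h']
  have hle : Submodule.span ℂ (Set.range fun ψ' : X' ⟶ X' ↦ pullbackOne X' ψ') ≤
      Subalgebra.toSubmodule (Algebra.adjoin ℂ
        (symmetricPullbackSpan X' h' : Set (Module.End ℂ (complexBetti X'.X 1)))) :=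
    Submodule.span_le.2 (by rintro _ ⟨ψ', rfl⟩; exact hB ψ')
  exact hle hT

/-- **«`B = Mat_m(D)`» travels along an isogeny**, pull-back form: if every `ψ'^*`, `ψ' ∈ End(X')`, lies in
`B(X')(h') ⊗ ℂ`, then every `ψ^*`, `ψ ∈ End(X)`, lies in `B(X)(f^* h') ⊗ ℂ`.
[cite: MoonenZarhin1998WeilClasses, §1 (chunk p0002 L45–46; chunk p0003 «B = Mat_m(D)»)] [cite: Milne1999LefschetzClasses, §1 p. 643] -/
theorem forall_pullbackOne_mem_adjoin_symmetricPullbackSpan_of_isIsogeny (hf : AbelianVariety.IsIsogeny f)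
    (h' : complexBetti X'.X 2)
    (hB : ∀ ψ' : X' ⟶ X', pullbackOne X' ψ' ∈
      Algebra.adjoin ℂ (symmetricPullbackSpan X' h' : Set (Module.End ℂ (complexBetti X'.X 1))))
    (ψ : X ⟶ X) :
    pullbackOne X ψ ∈ Algebra.adjoin ℂ
      (symmetricPullbackSpan X (complexBetti.map f.hom.hom.hom 2 h') : Set (Module.End ℂ (complexBetti X.X 1))) :=
  mem_adjoin_symmetricPullbackSpan_of_mem_span_of_isIsogeny hf h' hB (Submodule.subset_span ⟨ψ, rfl⟩)

/-- **`B(X) ⊗ ℂ ⊆ End⁰(X) ⊗ ℂ` always** (the subalgebra generated by `S_λ ⊗ ℂ` lies in the bicommutant `E'' = E`),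
as subspaces of `End_ℂ H¹(X(ℂ); ℂ)`. [cite: MoonenZarhin1998WeilClasses, §1 (chunk p0002 L56–58: B ⊆ End⁰(X))]
[cite: Milne1999LefschetzClasses, §1 Remark 1.2 (p. 643)] -/
theorem adjoin_symmetricPullbackSpan_le_span (hX : complexBetti X.X 2) :
    Subalgebra.toSubmodule (Algebra.adjoin ℂ
        (symmetricPullbackSpan X hX : Set (Module.End ℂ (complexBetti X.X 1)))) ≤
      Submodule.span ℂ (Set.range fun ψ : X ⟶ X ↦ pullbackOne X ψ) := by
  have hle : Algebra.adjoin ℂ (symmetricPullbackSpan X hX : Set (Module.End ℂ (complexBetti X.X 1))) ≤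
      Subalgebra.centralizer ℂ (centralizerAlgebra X : Set (Module.End ℂ (complexBetti X.X 1))) :=
    Algebra.adjoin_le fun T hT ↦ mem_bicommutant_iff_mem_span.2 (symmetricPullbackSpan_le_span hT)
  intro T hT
  exact mem_bicommutant_iff_mem_span.1 (hle ((Subalgebra.mem_toSubmodule _).1 hT))

end Transport

/-! ## Chapter I, Part 2. `X` isogenous to `Y^m`, `m ≥ 2`, any polarization -/

section Powers

variable {X A : AbelianVariety ℂ} {h : complexBetti A.X 2} {hX : complexBetti X.X 2}

/-- **Along an isogeny `f : X ⟶ A^{a+2}`, with the pulled-back product polarization class**: every pull-back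
`ψ^*`, `ψ ∈ End(X)`, lies in `B(X)(f^* Σᵢ prᵢ^* h) ⊗ ℂ` (the seat's `DivisorAlgebraPowers` transported by Part 1).
[cite: MoonenZarhin1998WeilClasses, §1 (chunk p0002 L45–46, L83–97; chunk p0003 «B = Mat_m(D)»)]
[cite: Milne1999LefschetzClasses, §1 p. 643] -/
theorem pullbackOne_mem_adjoin_symmetricPullbackSpan_of_isIsogeny_powSucc (hA0 : 0 < A.dim)
    (hh : h ∈ hodgeClassSpan A.dim A.X 1)
    (hnd : ∀ x : complexBetti A.X 1, (∀ y, polarizationPairingOne A.X h (A.dim - 1) x y = 0) → x = 0)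
    (htop : lefschetzPow h (A.dim - 1) 2 h ≠ 0) (a : ℕ) {f : X ⟶ A.powSucc (a + 1)}
    (hf : AbelianVariety.IsIsogeny f) (ψ : X ⟶ X) :
    pullbackOne X ψ ∈ Algebra.adjoin ℂ
      (symmetricPullbackSpan X (complexBetti.map f.hom.hom.hom 2 (powPolarizationClass A h (a + 1))) :
        Set (Module.End ℂ (complexBetti X.X 1))) :=
  forall_pullbackOne_mem_adjoin_symmetricPullbackSpan_of_isIsogeny hf _
    (pullbackOne_powSucc_mem_adjoin_symmetricPullbackSpan hA0 hh hnd htop a) ψ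

/-- **Moonen–Zarhin 1998 §1 «`m ≥ 2` ⟹ `Δ = D`», in the print's standing generality, on the carrier: for
`X` ISOGENOUS to a power `A^{a+2}` and ANY class `h_X ∈ B¹(X) ⊗ ℂ` with `Q_{h_X}` non-degenerate, every
pull-back `ψ^*`, `ψ ∈ End(X)`, lies in `B(X)(h_X) ⊗ ℂ`** — «everything only depends on `X` up to isogeny»
(Part 1), «`G_div(X)`» and `B` «do not depend on the choice of `λ`» (the seat's
`adjoin_symmetricPullbackSpan_eq_of_mem_hodgeClassSpan`), «we may therefore assume … `λ` is the product
polarization `μ^m`» (`powPolarizationClass`, whose hypotheses travel by the lane's `polarization_hypotheses_map`).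
[cite: MoonenZarhin1998WeilClasses, §1 (chunk p0002 L45–46, L59–61, L83–97; chunk p0003 «B = Mat_m(D)»)]
[cite: Milne1999LefschetzClasses, §1 pp. 643–644] -/
theorem pullbackOne_mem_adjoin_symmetricPullbackSpan_of_isIsogenous_powSucc (hA0 : 0 < A.dim)
    (hh : h ∈ hodgeClassSpan A.dim A.X 1)
    (hnd : ∀ x : complexBetti A.X 1, (∀ y, polarizationPairingOne A.X h (A.dim - 1) x y = 0) → x = 0)
    (htop : lefschetzPow h (A.dim - 1) 2 h ≠ 0) {a : ℕ} (hXA : AbelianVariety.IsIsogenous X (A.powSucc (a + 1)))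
    (hhX : hX ∈ hodgeClassSpan X.dim X.X 1)
    (hndX : ∀ x : complexBetti X.X 1, (∀ y, polarizationPairingOne X.X hX (X.dim - 1) x y = 0) → x = 0)
    (ψ : X ⟶ X) :
    pullbackOne X ψ ∈ Algebra.adjoin ℂ (symmetricPullbackSpan X hX : Set (Module.End ℂ (complexBetti X.X 1))) := by
  obtain ⟨f, hf⟩ := hXA
  obtain ⟨hfH, -, hndfH⟩ := polarization_hypotheses_map hf (powPolarizationClass_mem_hodgeClassSpan hh (a + 1))
    (lefschetzPow_powPolarizationClass_self_ne_zero hA0 htop (a + 1))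
    (eq_zero_of_forall_polarizationPairingOne_powPolarizationClass_eq_zero hA0 htop hnd (a + 1))
  rw [adjoin_symmetricPullbackSpan_eq_of_mem_hodgeClassSpan hhX hndX hfH hndfH]
  exact pullbackOne_mem_adjoin_symmetricPullbackSpan_of_isIsogeny_powSucc hA0 hh hnd htop a hf ψ

/-- **«`B = Mat_m(D)`» ⊗ ℂ in the print's standing generality: `B(X)(h_X) ⊗ ℂ = End⁰(X) ⊗ ℂ`** for `X`
isogenous to `A^{a+2}` and any `h_X ∈ B¹(X) ⊗ ℂ` with `Q_{h_X}` non-degenerate (as subspaces of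
`End_ℂ H¹(X(ℂ); ℂ)`). [cite: MoonenZarhin1998WeilClasses, §1 (chunk p0002 L45–46, L83–97; chunk p0003 «B = Mat_m(D)»)]
[cite: Milne1999LefschetzClasses, §1 Remark 1.2 (p. 643)] -/
theorem adjoin_symmetricPullbackSpan_eq_span_of_isIsogenous_powSucc (hA0 : 0 < A.dim)
    (hh : h ∈ hodgeClassSpan A.dim A.X 1)
    (hnd : ∀ x : complexBetti A.X 1, (∀ y, polarizationPairingOne A.X h (A.dim - 1) x y = 0) → x = 0)
    (htop : lefschetzPow h (A.dim - 1) 2 h ≠ 0) {a : ℕ} (hXA : AbelianVariety.IsIsogenous X (A.powSucc (a + 1)))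
    (hhX : hX ∈ hodgeClassSpan X.dim X.X 1)
    (hndX : ∀ x : complexBetti X.X 1, (∀ y, polarizationPairingOne X.X hX (X.dim - 1) x y = 0) → x = 0) :
    Subalgebra.toSubmodule (Algebra.adjoin ℂ
        (symmetricPullbackSpan X hX : Set (Module.End ℂ (complexBetti X.X 1)))) =
      Submodule.span ℂ (Set.range fun ψ : X ⟶ X ↦ pullbackOne X ψ) := by
  refine le_antisymm (adjoin_symmetricPullbackSpan_le_span hX) (Submodule.span_le.2 ?_)
  rintro _ ⟨ψ, rfl⟩
  exact pullbackOne_mem_adjoin_symmetricPullbackSpan_of_isIsogenous_powSucc hA0 hh hnd htop hXA hhX hndX ψ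

/-- **Moonen–Zarhin 1998 §1: «`G_div(X)` is the centralizer of `Δ = D` in `SP(V_Y, φ_Y)` …» in the print's
standing generality, on the carrier: `G_div(X)(h_X)(ℂ) = S(X)(h_X)(ℂ)` for every `X` ISOGENOUS to a power
`A^{a+2}` (`m = a + 2 ≥ 2`) and EVERY class `h_X ∈ B¹(X) ⊗ ℂ` with `Q_{h_X}` non-degenerate** — Moonen–Zarhin's
group (commuting with `S_λ ⊗ ℂ` only) is Milne's `S(X)` (commuting with all of `End⁰(X) ⊗ ℂ`).
[cite: MoonenZarhin1998WeilClasses, §1 (chunk p0002 L45–46, L66–71, L83–97)] [cite: Milne1999LefschetzClasses, §1 p. 644] -/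
theorem divisorLefschetzGroup_eq_unitaryCentralizerGroup_of_isIsogenous_powSucc (hA0 : 0 < A.dim)
    (hh : h ∈ hodgeClassSpan A.dim A.X 1)
    (hnd : ∀ x : complexBetti A.X 1, (∀ y, polarizationPairingOne A.X h (A.dim - 1) x y = 0) → x = 0)
    (htop : lefschetzPow h (A.dim - 1) 2 h ≠ 0) {a : ℕ} (hXA : AbelianVariety.IsIsogenous X (A.powSucc (a + 1)))
    (hhX : hX ∈ hodgeClassSpan X.dim X.X 1)
    (hndX : ∀ x : complexBetti X.X 1, (∀ y, polarizationPairingOne X.X hX (X.dim - 1) x y = 0) → x = 0) :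
    divisorLefschetzGroup X hX = unitaryCentralizerGroup X hX :=
  divisorLefschetzGroup_eq_unitaryCentralizerGroup_of_forall_mem_adjoin
    (pullbackOne_mem_adjoin_symmetricPullbackSpan_of_isIsogenous_powSucc hA0 hh hnd htop hXA hhX hndX)

/-- **«… embedded diagonally into `SP(V, φ)`», through the isogeny**: for an isogeny `f : X ⟶ A^{a+2}` and the
pulled-back product class `f^* Σᵢ prᵢ^* h`, the elements of `G_div(X)(ℂ)` are exactly the transports
`f^* ∘ u^{⊕(a+2)} ∘ (f^*)⁻¹` of the diagonal automorphisms, `u ∈ S(A)(h)(ℂ)` (the seat's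
`mem_divisorLefschetzGroup_powSucc_iff_exists_diagPow` carried by `isogenyConj`).
[cite: MoonenZarhin1998WeilClasses, §1 (chunk p0002 L45–46, L92–97)] [cite: Milne1999LefschetzClasses, §1 pp. 643–644] -/
theorem mem_divisorLefschetzGroup_iff_exists_isogenyConj_diagPow (hA0 : 0 < A.dim)
    (hh : h ∈ hodgeClassSpan A.dim A.X 1)
    (hnd : ∀ x : complexBetti A.X 1, (∀ y, polarizationPairingOne A.X h (A.dim - 1) x y = 0) → x = 0)
    (htop : lefschetzPow h (A.dim - 1) 2 h ≠ 0) (a : ℕ) {f : X ⟶ A.powSucc (a + 1)}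
    (hf : AbelianVariety.IsIsogeny f) {U : complexBetti X.X 1 ≃ₗ[ℂ] complexBetti X.X 1} :
    U ∈ divisorLefschetzGroup X (complexBetti.map f.hom.hom.hom 2 (powPolarizationClass A h (a + 1))) ↔
      ∃ u ∈ unitaryCentralizerGroup A h, isogenyConj hf (diagPow A u (a + 1)) = U := by
  constructor
  · intro hU
    have hU' : (isogenyConj hf).symm U ∈
        divisorLefschetzGroup (A.powSucc (a + 1)) (powPolarizationClass A h (a + 1)) := by
      rw [← isogenyConj_mem_divisorLefschetzGroup_iff hf, MulEquiv.apply_symm_apply]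
      exact hU
    obtain ⟨u, hu, e⟩ := (mem_divisorLefschetzGroup_powSucc_iff_exists_diagPow hA0 hh hnd htop a).1 hU'
    exact ⟨u, hu, by rw [e, MulEquiv.apply_symm_apply]⟩
  · rintro ⟨u, hu, rfl⟩
    exact (isogenyConj_mem_divisorLefschetzGroup_iff hf _).2
      (diagPow_mem_divisorLefschetzGroup_powSucc hA0 hh hnd htop a hu)

end Powers

/-! # Chapter II (row g15-#4). Lemma (1) and Lemma (3) as equalities when `B ⊗ ℂ = End⁰ ⊗ ℂ` -/
/-! ## Chapter II, Part 1. The mechanism: `B ⊗ ℂ = End⁰(X) ⊗ ℂ` closes Lemma (3) and Lemma (1) -/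

section General

variable {X : AbelianVariety ℂ} {hX : complexBetti X.X 2}

/-- **Lemma (3), first clause, `⊗ ℂ`, as an equivalence: `End(V_X)^{G_div(X)(ℂ)} = B ⊗ ℂ` whenever
`B ⊗ ℂ = End⁰(X) ⊗ ℂ`** — an endomorphism of `H¹(X(ℂ); ℂ)` commutes with every element of `G_div(X)(h_X)(ℂ)` iff
it lies in the subalgebra generated by `S_λ ⊗ ℂ` (`⊆`: it commutes with `Hg(X)(ℂ)|_{H¹} ≤ G_div`, hence lies in
`End⁰(X) ⊗ ℂ` by Deligne I 3.4 — the seat's `mem_span_pullbackOne_of_forall_mem_divisorLefschetzGroup_comm` — and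
`End⁰(X) ⊗ ℂ = B ⊗ ℂ` by `hB`; `⊇`: `G_div` centralizes `B`). [cite: MoonenZarhin1998WeilClasses, §1 Lemma (3) (chunk p0003 L5–6)]
[cite: Deligne1982HodgeCycles, I §3 Prop. 3.4] -/
theorem forall_mem_divisorLefschetzGroup_comm_iff_mem_adjoin (hhX : hX ∈ hodgeClassSpan X.dim X.X 1)
    (hB : ∀ ψ : X ⟶ X, pullbackOne X ψ ∈
      Algebra.adjoin ℂ (symmetricPullbackSpan X hX : Set (Module.End ℂ (complexBetti X.X 1))))
    {T : Module.End ℂ (complexBetti X.X 1)} :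
    (∀ u ∈ divisorLefschetzGroup X hX, ∀ y : complexBetti X.X 1, T (u y) = u (T y)) ↔
      T ∈ Algebra.adjoin ℂ (symmetricPullbackSpan X hX : Set (Module.End ℂ (complexBetti X.X 1))) := by
  constructor
  · intro hT
    have hle : Submodule.span ℂ (Set.range fun ψ : X ⟶ X ↦ pullbackOne X ψ) ≤
        Subalgebra.toSubmodule (Algebra.adjoin ℂ
          (symmetricPullbackSpan X hX : Set (Module.End ℂ (complexBetti X.X 1)))) :=
      Submodule.span_le.2 (by rintro _ ⟨ψ, rfl⟩; exact hB ψ)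
    exact hle (mem_span_pullbackOne_of_forall_mem_divisorLefschetzGroup_comm hhX T hT)
  · intro hT u hu y
    exact (divisorLefschetzGroup_comm_of_mem_adjoin hu hT y).symm

/-- **Lemma (3), first clause, `⊗ ℂ`, as an equality of sets: `End(V_X)^{G_div(X)(ℂ)} = B ⊗ ℂ`** (under
`B ⊗ ℂ = End⁰(X) ⊗ ℂ`). [cite: MoonenZarhin1998WeilClasses, §1 Lemma (3) (chunk p0003 L5–6)] [cite: Deligne1982HodgeCycles, I §3 Prop. 3.4] -/
theorem setOf_forall_mem_divisorLefschetzGroup_comm_eq_adjoin (hhX : hX ∈ hodgeClassSpan X.dim X.X 1)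
    (hB : ∀ ψ : X ⟶ X, pullbackOne X ψ ∈
      Algebra.adjoin ℂ (symmetricPullbackSpan X hX : Set (Module.End ℂ (complexBetti X.X 1)))) :
    {T : Module.End ℂ (complexBetti X.X 1) |
        ∀ u ∈ divisorLefschetzGroup X hX, ∀ y : complexBetti X.X 1, T (u y) = u (T y)} =
      (Algebra.adjoin ℂ (symmetricPullbackSpan X hX : Set (Module.End ℂ (complexBetti X.X 1))) :
        Set (Module.End ℂ (complexBetti X.X 1))) :=
  Set.ext fun _ ↦ forall_mem_divisorLefschetzGroup_comm_iff_mem_adjoin hhX hB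

/-- **Lemma (1) «the center of `G_div(X)` is `U_{K_B}`», `ℂ`-points, first form: an element of `G_div(X)(ℂ)` is
CENTRAL iff its underlying endomorphism lies in `B ⊗ ℂ`** (whenever `B ⊗ ℂ = End⁰(X) ⊗ ℂ`; `⇒`: a central
element commutes with `Hg|_{H¹} ≤ G_div`, so it lies in `End⁰ ⊗ ℂ = B ⊗ ℂ` — the seat's
`coe_mem_span_pullbackOne_of_mem_center_divisorLefschetzGroup`; `⇐`: `G_div` centralizes `B ⊗ ℂ` — the seat's
`mem_center_divisorLefschetzGroup_of_coe_mem_adjoin`). Such an element lies in `B ⊗ ℂ` and commutes with `B ⊗ ℂ`,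
i.e. in `Z(B) ⊗ ℂ = K_B ⊗ ℂ`. [cite: MoonenZarhin1998WeilClasses, §1 Lemma (1) (chunk p0002 L121–124)]
[cite: Deligne1982HodgeCycles, I §3 Prop. 3.4] -/
theorem mem_center_divisorLefschetzGroup_iff_coe_mem_adjoin (hhX : hX ∈ hodgeClassSpan X.dim X.X 1)
    (hB : ∀ ψ : X ⟶ X, pullbackOne X ψ ∈
      Algebra.adjoin ℂ (symmetricPullbackSpan X hX : Set (Module.End ℂ (complexBetti X.X 1))))
    {z : divisorLefschetzGroup X hX} :
    z ∈ Subgroup.center (divisorLefschetzGroup X hX) ↔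
      ((z : complexBetti X.X 1 ≃ₗ[ℂ] complexBetti X.X 1) : Module.End ℂ (complexBetti X.X 1)) ∈
        Algebra.adjoin ℂ (symmetricPullbackSpan X hX : Set (Module.End ℂ (complexBetti X.X 1))) := by
  refine ⟨fun hz ↦ ?_, mem_center_divisorLefschetzGroup_of_coe_mem_adjoin⟩
  have hle : Submodule.span ℂ (Set.range fun ψ : X ⟶ X ↦ pullbackOne X ψ) ≤
      Subalgebra.toSubmodule (Algebra.adjoin ℂ
        (symmetricPullbackSpan X hX : Set (Module.End ℂ (complexBetti X.X 1)))) :=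
    Submodule.span_le.2 (by rintro _ ⟨ψ, rfl⟩; exact hB ψ)
  exact hle (coe_mem_span_pullbackOne_of_mem_center_divisorLefschetzGroup hhX hz)

/-- **Lemma (1), second form: an element of `G_div(X)(ℂ)` is central iff its underlying endomorphism lies in
`End⁰(X) ⊗ ℂ`** (the `ℂ`-span of the pull-backs; under `B ⊗ ℂ = End⁰(X) ⊗ ℂ`).
[cite: MoonenZarhin1998WeilClasses, §1 Lemma (1) (chunk p0002 L121–124)] [cite: Deligne1982HodgeCycles, I §3 Prop. 3.4] -/
theorem mem_center_divisorLefschetzGroup_iff_coe_mem_span (hhX : hX ∈ hodgeClassSpan X.dim X.X 1)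
    (hB : ∀ ψ : X ⟶ X, pullbackOne X ψ ∈
      Algebra.adjoin ℂ (symmetricPullbackSpan X hX : Set (Module.End ℂ (complexBetti X.X 1))))
    {z : divisorLefschetzGroup X hX} :
    z ∈ Subgroup.center (divisorLefschetzGroup X hX) ↔
      ((z : complexBetti X.X 1 ≃ₗ[ℂ] complexBetti X.X 1) : Module.End ℂ (complexBetti X.X 1)) ∈
        Submodule.span ℂ (Set.range fun ψ : X ⟶ X ↦ pullbackOne X ψ) := by
  refine ⟨coe_mem_span_pullbackOne_of_mem_center_divisorLefschetzGroup hhX, fun hz ↦ ?_⟩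
  have hle : Submodule.span ℂ (Set.range fun ψ : X ⟶ X ↦ pullbackOne X ψ) ≤
      Subalgebra.toSubmodule (Algebra.adjoin ℂ
        (symmetricPullbackSpan X hX : Set (Module.End ℂ (complexBetti X.X 1)))) :=
    Submodule.span_le.2 (by rintro _ ⟨ψ, rfl⟩; exact hB ψ)
  exact mem_center_divisorLefschetzGroup_of_coe_mem_adjoin (hle hz)

/-- **Lemma (1) «`Z(G_div(X)) = U_{K_B}`, `U_{K_B}(R) = {a ∈ (K_B ⊗ R)^* | a a† = 1}`», `ℂ`-points, as the print's
set** (under `B ⊗ ℂ = End⁰(X) ⊗ ℂ`): an automorphism `U` of `H¹(X(ℂ); ℂ)` is a central element of `G_div(X)(h_X)(ℂ)`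
iff `U` lies in the CENTRE of `B ⊗ ℂ` (in `B ⊗ ℂ`, commuting with `B ⊗ ℂ` — i.e. in `K_B ⊗ ℂ`) and preserves
`Q_{h_X}` (the condition `a a† = 1`, cf. `forall_polarizationPairingOne_map_map_eq_iff_mul_adjoint_eq_one`).
[cite: MoonenZarhin1998WeilClasses, §1 Lemma (1) (chunk p0002 L121–124)] [cite: Deligne1982HodgeCycles, I §3 Prop. 3.4] -/
theorem mem_divisorLefschetzGroup_and_forall_comm_iff (hhX : hX ∈ hodgeClassSpan X.dim X.X 1)
    (hB : ∀ ψ : X ⟶ X, pullbackOne X ψ ∈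
      Algebra.adjoin ℂ (symmetricPullbackSpan X hX : Set (Module.End ℂ (complexBetti X.X 1))))
    {U : complexBetti X.X 1 ≃ₗ[ℂ] complexBetti X.X 1} :
    (U ∈ divisorLefschetzGroup X hX ∧ ∀ g ∈ divisorLefschetzGroup X hX, g * U = U * g) ↔
      (U : Module.End ℂ (complexBetti X.X 1)) ∈
          Algebra.adjoin ℂ (symmetricPullbackSpan X hX : Set (Module.End ℂ (complexBetti X.X 1))) ∧
        (∀ T ∈ Algebra.adjoin ℂ (symmetricPullbackSpan X hX : Set (Module.End ℂ (complexBetti X.X 1))),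
          (U : Module.End ℂ (complexBetti X.X 1)) * T = T * U) ∧
        ∀ x y : complexBetti X.X 1, polarizationPairingOne X.X hX (X.dim - 1) (U x) (U y) =
          polarizationPairingOne X.X hX (X.dim - 1) x y := by
  constructor
  · rintro ⟨hU, hc⟩
    refine ⟨?_, fun T hT ↦ LinearMap.ext fun x ↦ divisorLefschetzGroup_comm_of_mem_adjoin hU hT x, hU.2⟩
    have hz : (⟨U, hU⟩ : divisorLefschetzGroup X hX) ∈ Subgroup.center (divisorLefschetzGroup X hX) := by
      rw [Subgroup.mem_center_iff]
      intro g
      exact Subtype.ext (hc g g.2)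
    exact (mem_center_divisorLefschetzGroup_iff_coe_mem_adjoin hhX hB).1 hz
  · rintro ⟨hUB, hUc, hUQ⟩
    have hU : U ∈ divisorLefschetzGroup X hX := by
      refine ⟨fun T hT x ↦ ?_, hUQ⟩
      have e := LinearMap.congr_fun (hUc T (Algebra.subset_adjoin hT)) x
      simpa only [Module.End.mul_apply, LinearEquiv.coe_coe] using e
    refine ⟨hU, fun g hg ↦ ?_⟩
    have hz : (⟨U, hU⟩ : divisorLefschetzGroup X hX) ∈ Subgroup.center (divisorLefschetzGroup X hX) :=
      mem_center_divisorLefschetzGroup_of_coe_mem_adjoin hUB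
    have e := Subgroup.mem_center_iff.1 hz ⟨g, hg⟩
    exact congrArg Subtype.val e

/-- **The print's «`a a† = 1`», first spelling**: for an endomorphism `a` of `H¹(X(ℂ); ℂ)` with a `Q_h`-adjoint `a'`
(`Q_h(a x, y) = Q_h(x, a' y)`) and `Q_h` non-degenerate, `a` preserves `Q_h` iff `a' a = 1` (`Q_h` is alternating on
`H¹`, so non-degeneracy in one slot gives the other). [cite: MoonenZarhin1998WeilClasses, §1 Lemma (1) (chunk p0002 L121–124: «a a† = 1»)]
[cite: HatcherAT2002, Thm. 3.11] -/
theorem forall_polarizationPairingOne_map_map_eq_iff_adjoint_mul_eq_one {j : ℕ}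
    (hnd : ∀ x : complexBetti X.X 1, (∀ y, polarizationPairingOne X.X hX j x y = 0) → x = 0)
    {a a' : Module.End ℂ (complexBetti X.X 1)}
    (hadj : ∀ x y : complexBetti X.X 1, polarizationPairingOne X.X hX j (a x) y =
      polarizationPairingOne X.X hX j x (a' y)) :
    (∀ x y : complexBetti X.X 1, polarizationPairingOne X.X hX j (a x) (a y) = polarizationPairingOne X.X hX j x y) ↔
      a' * a = 1 := by
  constructor
  · intro H
    refine LinearMap.ext fun y ↦ ?_
    rw [Module.End.mul_apply, Module.End.one_apply]
    have key : ∀ x, polarizationPairingOne X.X hX j x (a' (a y) - y) = 0 := fun x ↦ by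
      rw [map_sub, ← hadj, H, sub_self]
    exact sub_eq_zero.1 (hnd _ fun x ↦ by rw [polarizationPairingOne_swap, key, neg_zero])
  · intro H x y
    rw [hadj, ← Module.End.mul_apply, H, Module.End.one_apply]

/-- **«`a a† = 1`», the print's order** (`a a' = 1`; on the finite-dimensional `H¹` a one-sided inverse is
two-sided). [cite: MoonenZarhin1998WeilClasses, §1 Lemma (1) (chunk p0002 L121–124: «a a† = 1»)] -/
theorem forall_polarizationPairingOne_map_map_eq_iff_mul_adjoint_eq_one {j : ℕ}
    (hnd : ∀ x : complexBetti X.X 1, (∀ y, polarizationPairingOne X.X hX j x y = 0) → x = 0)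
    {a a' : Module.End ℂ (complexBetti X.X 1)}
    (hadj : ∀ x y : complexBetti X.X 1, polarizationPairingOne X.X hX j (a x) y =
      polarizationPairingOne X.X hX j x (a' y)) :
    (∀ x y : complexBetti X.X 1, polarizationPairingOne X.X hX j (a x) (a y) = polarizationPairingOne X.X hX j x y) ↔
      a * a' = 1 := by
  haveI : Module.Finite ℂ (complexBetti X.X 1) := abelianVarietyCohomologyExteriorH1_holds.finite_one X
  rw [forall_polarizationPairingOne_map_map_eq_iff_adjoint_mul_eq_one hnd hadj, mul_eq_one_comm]

end General

/-! ## Chapter II, Part 2. `X` isogenous to `Y^m`, `m ≥ 2` (and the powers themselves) -/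

section Powers

variable {X A : AbelianVariety ℂ} {h : complexBetti A.X 2} {hX : complexBetti X.X 2}

/-- **Lemma (3) «`End(V_X)^{G_div(X)} = B`» ⊗ ℂ for `X ∼ Y^m`, `m ≥ 2`, any polarization class, on the carrier**:
for `X` isogenous to `A^{a+2}` (`0 < dim A`, `h ∈ B¹(A) ⊗ ℂ` with `Q_h` non-degenerate and `h^{dim A} ≠ 0`) and
`h_X ∈ B¹(X) ⊗ ℂ` with `Q_{h_X}` non-degenerate, an endomorphism of `H¹(X(ℂ); ℂ)` commutes with `G_div(X)(h_X)(ℂ)` iff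
it lies in `B(X)(h_X) ⊗ ℂ` (`= End⁰(X) ⊗ ℂ`, Chapter I).
[cite: MoonenZarhin1998WeilClasses, §1 Lemma (3) (chunk p0003 L5–6) and «Δ = D» (chunk p0002 L96–97)]
[cite: Deligne1982HodgeCycles, I §3 Prop. 3.4] -/
theorem forall_mem_divisorLefschetzGroup_comm_iff_mem_adjoin_of_isIsogenous_powSucc (hA0 : 0 < A.dim)
    (hh : h ∈ hodgeClassSpan A.dim A.X 1)
    (hnd : ∀ x : complexBetti A.X 1, (∀ y, polarizationPairingOne A.X h (A.dim - 1) x y = 0) → x = 0)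
    (htop : lefschetzPow h (A.dim - 1) 2 h ≠ 0) {a : ℕ} (hXA : AbelianVariety.IsIsogenous X (A.powSucc (a + 1)))
    (hhX : hX ∈ hodgeClassSpan X.dim X.X 1)
    (hndX : ∀ x : complexBetti X.X 1, (∀ y, polarizationPairingOne X.X hX (X.dim - 1) x y = 0) → x = 0)
    {T : Module.End ℂ (complexBetti X.X 1)} :
    (∀ u ∈ divisorLefschetzGroup X hX, ∀ y : complexBetti X.X 1, T (u y) = u (T y)) ↔
      T ∈ Algebra.adjoin ℂ (symmetricPullbackSpan X hX : Set (Module.End ℂ (complexBetti X.X 1))) :=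
  forall_mem_divisorLefschetzGroup_comm_iff_mem_adjoin hhX
    (pullbackOne_mem_adjoin_symmetricPullbackSpan_of_isIsogenous_powSucc hA0 hh hnd htop hXA hhX hndX)

/-- **Lemma (1) «the center of `G_div(X)` is `U_{K_B}`», `ℂ`-points, for `X ∼ Y^m`, `m ≥ 2`, any polarization
class**: an element of `G_div(X)(h_X)(ℂ)` is central iff its underlying endomorphism lies in `B(X)(h_X) ⊗ ℂ`
(`= End⁰(X) ⊗ ℂ`). [cite: MoonenZarhin1998WeilClasses, §1 Lemma (1) (chunk p0002 L121–124) and «Δ = D» (L96–97)]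
[cite: Deligne1982HodgeCycles, I §3 Prop. 3.4] -/
theorem mem_center_divisorLefschetzGroup_iff_coe_mem_adjoin_of_isIsogenous_powSucc (hA0 : 0 < A.dim)
    (hh : h ∈ hodgeClassSpan A.dim A.X 1)
    (hnd : ∀ x : complexBetti A.X 1, (∀ y, polarizationPairingOne A.X h (A.dim - 1) x y = 0) → x = 0)
    (htop : lefschetzPow h (A.dim - 1) 2 h ≠ 0) {a : ℕ} (hXA : AbelianVariety.IsIsogenous X (A.powSucc (a + 1)))
    (hhX : hX ∈ hodgeClassSpan X.dim X.X 1)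
    (hndX : ∀ x : complexBetti X.X 1, (∀ y, polarizationPairingOne X.X hX (X.dim - 1) x y = 0) → x = 0)
    {z : divisorLefschetzGroup X hX} :
    z ∈ Subgroup.center (divisorLefschetzGroup X hX) ↔
      ((z : complexBetti X.X 1 ≃ₗ[ℂ] complexBetti X.X 1) : Module.End ℂ (complexBetti X.X 1)) ∈
        Algebra.adjoin ℂ (symmetricPullbackSpan X hX : Set (Module.End ℂ (complexBetti X.X 1))) :=
  mem_center_divisorLefschetzGroup_iff_coe_mem_adjoin hhX
    (pullbackOne_mem_adjoin_symmetricPullbackSpan_of_isIsogenous_powSucc hA0 hh hnd htop hXA hhX hndX)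

/-- **Lemma (1), `ℂ`-points, for `X ∼ Y^m`, `m ≥ 2`: a central element of `G_div(X)(ℂ)` lies in `End⁰(X) ⊗ ℂ`, and
conversely** (second form). [cite: MoonenZarhin1998WeilClasses, §1 Lemma (1) (chunk p0002 L121–124) and «Δ = D» (L96–97)]
[cite: Deligne1982HodgeCycles, I §3 Prop. 3.4] -/
theorem mem_center_divisorLefschetzGroup_iff_coe_mem_span_of_isIsogenous_powSucc (hA0 : 0 < A.dim)
    (hh : h ∈ hodgeClassSpan A.dim A.X 1)
    (hnd : ∀ x : complexBetti A.X 1, (∀ y, polarizationPairingOne A.X h (A.dim - 1) x y = 0) → x = 0)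
    (htop : lefschetzPow h (A.dim - 1) 2 h ≠ 0) {a : ℕ} (hXA : AbelianVariety.IsIsogenous X (A.powSucc (a + 1)))
    (hhX : hX ∈ hodgeClassSpan X.dim X.X 1)
    (hndX : ∀ x : complexBetti X.X 1, (∀ y, polarizationPairingOne X.X hX (X.dim - 1) x y = 0) → x = 0)
    {z : divisorLefschetzGroup X hX} :
    z ∈ Subgroup.center (divisorLefschetzGroup X hX) ↔
      ((z : complexBetti X.X 1 ≃ₗ[ℂ] complexBetti X.X 1) : Module.End ℂ (complexBetti X.X 1)) ∈
        Submodule.span ℂ (Set.range fun ψ : X ⟶ X ↦ pullbackOne X ψ) :=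
  mem_center_divisorLefschetzGroup_iff_coe_mem_span hhX
    (pullbackOne_mem_adjoin_symmetricPullbackSpan_of_isIsogenous_powSucc hA0 hh hnd htop hXA hhX hndX)

/-- **Lemma (1) «`Z(G_div(X)) = U_{K_B}`» as the print's set, `ℂ`-points, for `X ∼ Y^m`, `m ≥ 2`, any polarization
class**: `U` is a central element of `G_div(X)(h_X)(ℂ)` iff `U ∈ Z(B ⊗ ℂ) = K_B ⊗ ℂ` and `U` preserves `Q_{h_X}`
(«`a a† = 1`»). [cite: MoonenZarhin1998WeilClasses, §1 Lemma (1) (chunk p0002 L121–124) and «Δ = D» (L96–97)]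
[cite: Deligne1982HodgeCycles, I §3 Prop. 3.4] -/
theorem mem_divisorLefschetzGroup_and_forall_comm_iff_of_isIsogenous_powSucc (hA0 : 0 < A.dim)
    (hh : h ∈ hodgeClassSpan A.dim A.X 1)
    (hnd : ∀ x : complexBetti A.X 1, (∀ y, polarizationPairingOne A.X h (A.dim - 1) x y = 0) → x = 0)
    (htop : lefschetzPow h (A.dim - 1) 2 h ≠ 0) {a : ℕ} (hXA : AbelianVariety.IsIsogenous X (A.powSucc (a + 1)))
    (hhX : hX ∈ hodgeClassSpan X.dim X.X 1)
    (hndX : ∀ x : complexBetti X.X 1, (∀ y, polarizationPairingOne X.X hX (X.dim - 1) x y = 0) → x = 0)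
    {U : complexBetti X.X 1 ≃ₗ[ℂ] complexBetti X.X 1} :
    (U ∈ divisorLefschetzGroup X hX ∧ ∀ g ∈ divisorLefschetzGroup X hX, g * U = U * g) ↔
      (U : Module.End ℂ (complexBetti X.X 1)) ∈
          Algebra.adjoin ℂ (symmetricPullbackSpan X hX : Set (Module.End ℂ (complexBetti X.X 1))) ∧
        (∀ T ∈ Algebra.adjoin ℂ (symmetricPullbackSpan X hX : Set (Module.End ℂ (complexBetti X.X 1))),
          (U : Module.End ℂ (complexBetti X.X 1)) * T = T * U) ∧
        ∀ x y : complexBetti X.X 1, polarizationPairingOne X.X hX (X.dim - 1) (U x) (U y) =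
          polarizationPairingOne X.X hX (X.dim - 1) x y :=
  mem_divisorLefschetzGroup_and_forall_comm_iff hhX
    (pullbackOne_mem_adjoin_symmetricPullbackSpan_of_isIsogenous_powSucc hA0 hh hnd htop hXA hhX hndX)

/-- **Lemma (3) «`End(V_X)^{G_div(X)} = B`» ⊗ ℂ for the powers `X = A^{a+2}` themselves with the product class
`Σᵢ prᵢ^* h`** (no isogeny, no change of polarization). [cite: MoonenZarhin1998WeilClasses, §1 Lemma (3) (chunk p0003 L5–6) and «Δ = D» (chunk p0002 L96–97)]
[cite: Deligne1982HodgeCycles, I §3 Prop. 3.4] -/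
theorem forall_mem_divisorLefschetzGroup_powSucc_comm_iff_mem_adjoin (hA0 : 0 < A.dim)
    (hh : h ∈ hodgeClassSpan A.dim A.X 1)
    (hnd : ∀ x : complexBetti A.X 1, (∀ y, polarizationPairingOne A.X h (A.dim - 1) x y = 0) → x = 0)
    (htop : lefschetzPow h (A.dim - 1) 2 h ≠ 0) (a : ℕ) {T : Module.End ℂ (complexBetti (A.powSucc (a + 1)).X 1)} :
    (∀ u ∈ divisorLefschetzGroup (A.powSucc (a + 1)) (powPolarizationClass A h (a + 1)),
        ∀ y : complexBetti (A.powSucc (a + 1)).X 1, T (u y) = u (T y)) ↔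
      T ∈ Algebra.adjoin ℂ (symmetricPullbackSpan (A.powSucc (a + 1)) (powPolarizationClass A h (a + 1)) :
        Set (Module.End ℂ (complexBetti (A.powSucc (a + 1)).X 1))) :=
  forall_mem_divisorLefschetzGroup_comm_iff_mem_adjoin (powPolarizationClass_mem_hodgeClassSpan hh (a + 1))
    (pullbackOne_powSucc_mem_adjoin_symmetricPullbackSpan hA0 hh hnd htop a)

/-- **Lemma (1) for the powers `A^{a+2}` themselves with the product class**: an element of `G_div(A^{a+2})(ℂ)` is
central iff it lies in `B ⊗ ℂ = End⁰(A^{a+2}) ⊗ ℂ`. [cite: MoonenZarhin1998WeilClasses, §1 Lemma (1) (chunk p0002 L121–124) and «Δ = D» (L96–97)]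
[cite: Deligne1982HodgeCycles, I §3 Prop. 3.4] -/
theorem mem_center_divisorLefschetzGroup_powSucc_iff_coe_mem_adjoin (hA0 : 0 < A.dim)
    (hh : h ∈ hodgeClassSpan A.dim A.X 1)
    (hnd : ∀ x : complexBetti A.X 1, (∀ y, polarizationPairingOne A.X h (A.dim - 1) x y = 0) → x = 0)
    (htop : lefschetzPow h (A.dim - 1) 2 h ≠ 0) (a : ℕ)
    {z : divisorLefschetzGroup (A.powSucc (a + 1)) (powPolarizationClass A h (a + 1))} :
    z ∈ Subgroup.center (divisorLefschetzGroup (A.powSucc (a + 1)) (powPolarizationClass A h (a + 1))) ↔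
      ((z : complexBetti (A.powSucc (a + 1)).X 1 ≃ₗ[ℂ] complexBetti (A.powSucc (a + 1)).X 1) :
          Module.End ℂ (complexBetti (A.powSucc (a + 1)).X 1)) ∈
        Algebra.adjoin ℂ (symmetricPullbackSpan (A.powSucc (a + 1)) (powPolarizationClass A h (a + 1)) :
          Set (Module.End ℂ (complexBetti (A.powSucc (a + 1)).X 1))) :=
  mem_center_divisorLefschetzGroup_iff_coe_mem_adjoin (powPolarizationClass_mem_hodgeClassSpan hh (a + 1))
    (pullbackOne_powSucc_mem_adjoin_symmetricPullbackSpan hA0 hh hnd htop a)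

end Powers

/-! # Chapter III (row g15-#5). Products -/
/-- `(f^*).hom c = f^* c`. [folklore] -/
private theorem hom_apply'' {Y Z : SchemeOver ℂ} (f : Y ⟶ Z) (k : ℕ) (c : complexBetti Z k) :
    (complexBetti.map f k).hom c = complexBetti.map f k c := rfl

/-! ## Chapter III, Part 1. The block embedding `T ↦ 0 ⊕ T` of the second factor -/

section Snd

variable {X A : AbelianVariety ℂ} {hX : complexBetti X.X 2} {h : complexBetti A.X 2}

/-- **`0 ⊕ 1 = (pr_A ≫ ι_A)^*`**, the projector onto `pr_A^* H¹(A)`. [cite: HatcherAT2002, §3.2 Thm. 3.16]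
[cite: Milne1999LefschetzClasses, §1 p. 643 (V(A₁ × A₂) = V(A₁) ⊕ V(A₂))] -/
theorem prodBlockDiag_zero_one :
    prodBlockDiag (0 : Module.End ℂ (complexBetti X.X 1)) (1 : Module.End ℂ (complexBetti A.X 1)) =
      pullbackOne (X.prod A) (AbelianVariety.snd X A ≫ AbelianVariety.prodLift (0 : A ⟶ X) (𝟙 A)) := by
  refine LinearMap.ext fun x ↦ ?_
  rw [prodBlockDiag_apply, LinearMap.zero_apply, map_zero, zero_add, Module.End.one_apply]
  simp only [hom_apply'']
  rw [complexBetti_map_comp_apply]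

/-- **`T ↦ 0 ⊕ T` is multiplicative.** [cite: Milne1999LefschetzClasses, §1 p. 643] [cite: HatcherAT2002, §3.2 Thm. 3.16] -/
theorem prodBlockDiag_zero_left_mul (S T : Module.End ℂ (complexBetti A.X 1)) :
    prodBlockDiag (0 : Module.End ℂ (complexBetti X.X 1)) S * prodBlockDiag 0 T = prodBlockDiag 0 (S * T) := by
  rw [← prodBlockDiag_mul, mul_zero]

/-- **`0 ⊕ φ^* = (pr_A ≫ φ ≫ ι_A)^*`: the embedding carries `End⁰(A) ⊗ ℂ` into `End⁰(X × A) ⊗ ℂ`.**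
[cite: Milne1999LefschetzClasses, §1 p. 643] -/
theorem prodBlockDiag_zero_left_mem_span {S : Module.End ℂ (complexBetti A.X 1)}
    (hS : S ∈ Submodule.span ℂ (Set.range fun φ : A ⟶ A ↦ pullbackOne A φ)) :
    prodBlockDiag (0 : Module.End ℂ (complexBetti X.X 1)) S ∈
      Submodule.span ℂ (Set.range fun ψ : X.prod A ⟶ X.prod A ↦ pullbackOne (X.prod A) ψ) := by
  induction hS using Submodule.span_induction with
  | mem S hS =>
    obtain ⟨φ, rfl⟩ := hS
    refine Submodule.subset_span ⟨AbelianVariety.snd X A ≫ φ ≫ AbelianVariety.prodLift (0 : A ⟶ X) (𝟙 A), ?_⟩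
    refine LinearMap.ext fun x ↦ ?_
    rw [prodBlockDiag_apply, LinearMap.zero_apply, map_zero, zero_add]
    simp only [hom_apply'']
    rw [complexBetti_map_comp_apply, complexBetti_map_comp_apply]
  | zero =>
    rw [show prodBlockDiag (0 : Module.End ℂ (complexBetti X.X 1)) (0 : Module.End ℂ (complexBetti A.X 1)) = 0 from
      LinearMap.ext fun x ↦ by rw [prodBlockDiag_apply, LinearMap.zero_apply, LinearMap.zero_apply, map_zero,
        map_zero, add_zero, LinearMap.zero_apply]]
    exact Submodule.zero_mem _
  | add S S' _ _ hS hS' =>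
    rw [show prodBlockDiag (0 : Module.End ℂ (complexBetti X.X 1)) (S + S') = prodBlockDiag 0 S + prodBlockDiag 0 S' from
      LinearMap.ext fun x ↦ by simp only [prodBlockDiag_apply, LinearMap.add_apply, LinearMap.zero_apply, map_zero,
        map_add, zero_add]]
    exact Submodule.add_mem _ hS hS'
  | smul c S _ hS =>
    rw [show prodBlockDiag (0 : Module.End ℂ (complexBetti X.X 1)) (c • S) = c • prodBlockDiag 0 S from
      LinearMap.ext fun x ↦ by simp only [prodBlockDiag_apply, LinearMap.smul_apply, LinearMap.zero_apply, map_zero,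
        map_smul, zero_add]]
    exact Submodule.smul_mem _ c hS

/-- **The `A`–`A` block of `Q_H`, left form**: `Q_H(pr_A^* b, y) = C(dim X + dim A − 1, dim X) ·
pr_X^* h_X^{dim X} ⌣ pr_A^* Q_h(b, ι_A^* y)`. [cite: Milne1999LefschetzClasses, §1 p. 643] [cite: LangeBirkenhake1992, §5.3] -/
theorem polarizationPairingOne_prod_map_snd_left (hX0 : 0 < X.dim) (hA0 : 0 < A.dim) (b : complexBetti A.X 1)
    (y : complexBetti (X.prod A).X 1) :
    polarizationPairingOne (X.prod A).X (prodPolarizationClass X A hX h) ((X.prod A).dim - 1)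
        (complexBetti.map (AbelianVariety.snd X A).hom.hom.hom 1 b) y =
      ((((X.prod A).dim - 1).choose (X.dim - 1 + 1) : ℕ) : ℂ) • cupProduct (prod_topDeg_eq hX0 hA0)
        (complexBetti.map (AbelianVariety.fst X A).hom.hom.hom (2 + 2 * (X.dim - 1))
          (lefschetzPow hX (X.dim - 1) 2 hX))
        (complexBetti.map (AbelianVariety.snd X A).hom.hom.hom (2 + 2 * (A.dim - 1))
          (polarizationPairingOne A.X h (A.dim - 1) b
            (complexBetti.map (AbelianVariety.prodLift (0 : A ⟶ X) (𝟙 A)).hom.hom.hom 1 y))) := by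
  conv_lhs => rw [eq_map_fst_add_map_snd_one y]
  rw [map_add, polarizationPairingOne_prod_map_snd_map_fst hX h hX0 hA0,
    polarizationPairingOne_prod_map_snd_map_snd hX h hX0 hA0, zero_add]

/-- **The `A`–`A` block of `Q_H`, right form**: `Q_H(x, pr_A^* b) = C(dim X + dim A − 1, dim X) ·
pr_X^* h_X^{dim X} ⌣ pr_A^* Q_h(ι_A^* x, b)`. [cite: Milne1999LefschetzClasses, §1 p. 643] [cite: LangeBirkenhake1992, §5.3] -/
theorem polarizationPairingOne_prod_map_snd_right (hX0 : 0 < X.dim) (hA0 : 0 < A.dim)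
    (x : complexBetti (X.prod A).X 1) (b : complexBetti A.X 1) :
    polarizationPairingOne (X.prod A).X (prodPolarizationClass X A hX h) ((X.prod A).dim - 1) x
        (complexBetti.map (AbelianVariety.snd X A).hom.hom.hom 1 b) =
      ((((X.prod A).dim - 1).choose (X.dim - 1 + 1) : ℕ) : ℂ) • cupProduct (prod_topDeg_eq hX0 hA0)
        (complexBetti.map (AbelianVariety.fst X A).hom.hom.hom (2 + 2 * (X.dim - 1))
          (lefschetzPow hX (X.dim - 1) 2 hX))
        (complexBetti.map (AbelianVariety.snd X A).hom.hom.hom (2 + 2 * (A.dim - 1))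
          (polarizationPairingOne A.X h (A.dim - 1)
            (complexBetti.map (AbelianVariety.prodLift (0 : A ⟶ X) (𝟙 A)).hom.hom.hom 1 x) b)) := by
  conv_lhs => rw [eq_map_fst_add_map_snd_one x]
  rw [LinearMap.map_add₂, polarizationPairingOne_prod_map_fst_map_snd hX h hX0 hA0,
    polarizationPairingOne_prod_map_snd_map_snd hX h hX0 hA0, zero_add]

/-- **`T ↦ 0 ⊕ T` carries `Q_h`-self-adjoint operators to `Q_H`-self-adjoint ones.**
[cite: Milne1999LefschetzClasses, §1 p. 643] [cite: LangeBirkenhake1992, §5.3] -/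
theorem prodBlockDiag_zero_left_comm_polarizationPairingOne (hX0 : 0 < X.dim) (hA0 : 0 < A.dim)
    {S : Module.End ℂ (complexBetti A.X 1)}
    (hS : ∀ b b' : complexBetti A.X 1, polarizationPairingOne A.X h (A.dim - 1) (S b) b' =
      polarizationPairingOne A.X h (A.dim - 1) b (S b')) (x y : complexBetti (X.prod A).X 1) :
    polarizationPairingOne (X.prod A).X (prodPolarizationClass X A hX h) ((X.prod A).dim - 1)
        (prodBlockDiag (0 : Module.End ℂ (complexBetti X.X 1)) S x) y =
      polarizationPairingOne (X.prod A).X (prodPolarizationClass X A hX h) ((X.prod A).dim - 1) x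
        (prodBlockDiag (0 : Module.End ℂ (complexBetti X.X 1)) S y) := by
  rw [prodBlockDiag_apply, prodBlockDiag_apply, LinearMap.zero_apply, LinearMap.zero_apply, map_zero, zero_add,
    zero_add, polarizationPairingOne_prod_map_snd_left hX0 hA0, polarizationPairingOne_prod_map_snd_right hX0 hA0,
    hS]

/-- **`T ↦ 0 ⊕ T` carries `S_λ(A) ⊗ ℂ` into `S_λ(X × A) ⊗ ℂ`.** [cite: MoonenZarhin1998WeilClasses, §1 (chunk p0002: S_λ, «α† = (α*_{ji})»)]
[cite: Milne1999LefschetzClasses, §1 p. 643] -/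
theorem prodBlockDiag_zero_left_mem_symmetricPullbackSpan_prod (hX0 : 0 < X.dim) (hA0 : 0 < A.dim)
    {S : Module.End ℂ (complexBetti A.X 1)} (hS : S ∈ symmetricPullbackSpan A h) :
    prodBlockDiag (0 : Module.End ℂ (complexBetti X.X 1)) S ∈
      symmetricPullbackSpan (X.prod A) (prodPolarizationClass X A hX h) :=
  ⟨prodBlockDiag_zero_left_mem_span hS.1, prodBlockDiag_zero_left_comm_polarizationPairingOne hX0 hA0 hS.2⟩

/-- **The projector `(pr_A ≫ ι_A)^* = 0 ⊕ 1` lies in `S_λ(X × A) ⊗ ℂ`.** [cite: MoonenZarhin1998WeilClasses, §1 (chunk p0002: S_λ)]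
[cite: Milne1999LefschetzClasses, §1 p. 643] -/
theorem projSnd_mem_symmetricPullbackSpan_prod (hX0 : 0 < X.dim) (hA0 : 0 < A.dim) :
    pullbackOne (X.prod A) (AbelianVariety.snd X A ≫ AbelianVariety.prodLift (0 : A ⟶ X) (𝟙 A)) ∈
      symmetricPullbackSpan (X.prod A) (prodPolarizationClass X A hX h) := by
  rw [← prodBlockDiag_zero_one]
  exact prodBlockDiag_zero_left_mem_symmetricPullbackSpan_prod hX0 hA0 one_mem_symmetricPullbackSpan

/-- **`T ↦ 0 ⊕ T` carries `B(A) ⊗ ℂ` into `B(X × A) ⊗ ℂ`.** [cite: MoonenZarhin1998WeilClasses, §1 (chunk p0002: B)]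
[cite: Milne1999LefschetzClasses, §1 p. 643] -/
theorem prodBlockDiag_zero_left_mem_adjoin_symmetricPullbackSpan_prod (hX0 : 0 < X.dim) (hA0 : 0 < A.dim)
    {T : Module.End ℂ (complexBetti A.X 1)}
    (hT : T ∈ Algebra.adjoin ℂ (symmetricPullbackSpan A h : Set (Module.End ℂ (complexBetti A.X 1)))) :
    prodBlockDiag (0 : Module.End ℂ (complexBetti X.X 1)) T ∈
      Algebra.adjoin ℂ (symmetricPullbackSpan (X.prod A) (prodPolarizationClass X A hX h) :
        Set (Module.End ℂ (complexBetti (X.prod A).X 1))) := by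
  induction hT using Algebra.adjoin_induction with
  | mem S hS => exact Algebra.subset_adjoin (prodBlockDiag_zero_left_mem_symmetricPullbackSpan_prod hX0 hA0 hS)
  | algebraMap r =>
    rw [Algebra.algebraMap_eq_smul_one,
      show prodBlockDiag (0 : Module.End ℂ (complexBetti X.X 1)) (r • (1 : Module.End ℂ (complexBetti A.X 1))) =
          r • prodBlockDiag 0 1 from
        LinearMap.ext fun x ↦ by simp only [prodBlockDiag_apply, LinearMap.smul_apply, LinearMap.zero_apply,
          map_zero, map_smul, zero_add]]
    exact Subalgebra.smul_mem _ (Algebra.subset_adjoin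
      (prodBlockDiag_zero_left_mem_symmetricPullbackSpan_prod hX0 hA0 one_mem_symmetricPullbackSpan)) r
  | add S T _ _ hS hT =>
    rw [show prodBlockDiag (0 : Module.End ℂ (complexBetti X.X 1)) (S + T) = prodBlockDiag 0 S + prodBlockDiag 0 T from
      LinearMap.ext fun x ↦ by simp only [prodBlockDiag_apply, LinearMap.add_apply, LinearMap.zero_apply, map_zero,
        map_add, zero_add]]
    exact add_mem hS hT
  | mul S T _ _ hS hT => rw [← prodBlockDiag_zero_left_mul]; exact mul_mem hS hT

end Snd

/-! ## Chapter III, Part 2. `B(X × A) ⊗ ℂ = End⁰(X × A) ⊗ ℂ` from the two factors -/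

section Prod

variable {X A : AbelianVariety ℂ} {hX : complexBetti X.X 2} {h : complexBetti A.X 2}

/-- **«`Δ = D`» is stable under products.** Let `X`, `A` be complex abelian varieties of positive dimension with
classes `h_X ∈ B¹(X) ⊗ ℂ`, `h ∈ B¹(A) ⊗ ℂ`, non-degenerate pairings and non-zero top powers, such that every `φ^*`,
`φ ∈ End(X)`, lies in `B(X)(h_X) ⊗ ℂ` and every `φ^*`, `φ ∈ End(A)`, lies in `B(A)(h) ⊗ ℂ`. Then every `ψ^*`,
`ψ ∈ End(X × A)`, lies in `B(X × A)(pr_X^* h_X + pr_A^* h) ⊗ ℂ`: with `e = (pr_X ≫ ι_X)^*`,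
`ψ^* = eψ^*e + eψ^*(1−e) + (1−e)ψ^*e + (1−e)ψ^*(1−e)`, the diagonal corners are `(ι_X ≫ ψ ≫ pr_X)^* ⊕ 0` and
`0 ⊕ (ι_A ≫ ψ ≫ pr_A)^*` (block embeddings of `B(X)`, `B(A)`), the off-diagonal corners lie in `B ⊗ ℂ` by the
hermitian elements (the seat's `mul_mul_one_sub_mem_adjoin_symmetricPullbackSpan`). [cite: MoonenZarhin1998WeilClasses, §1 (chunk p0002 L56–58, L87–97; chunk p0003 «B = Mat_m(D)»)]
[cite: Milne1999LefschetzClasses, §1 p. 643] -/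
theorem pullbackOne_prod_mem_adjoin_symmetricPullbackSpan_of_forall (hX0 : 0 < X.dim) (hA0 : 0 < A.dim)
    (hHX : hX ∈ hodgeClassSpan X.dim X.X 1) (hh : h ∈ hodgeClassSpan A.dim A.X 1)
    (hndX : ∀ x : complexBetti X.X 1, (∀ y, polarizationPairingOne X.X hX (X.dim - 1) x y = 0) → x = 0)
    (hnd : ∀ x : complexBetti A.X 1, (∀ y, polarizationPairingOne A.X h (A.dim - 1) x y = 0) → x = 0)
    (hXtop : lefschetzPow hX (X.dim - 1) 2 hX ≠ 0) (htop : lefschetzPow h (A.dim - 1) 2 h ≠ 0)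
    (hBX : ∀ φ : X ⟶ X, pullbackOne X φ ∈
      Algebra.adjoin ℂ (symmetricPullbackSpan X hX : Set (Module.End ℂ (complexBetti X.X 1))))
    (hBA : ∀ φ : A ⟶ A, pullbackOne A φ ∈
      Algebra.adjoin ℂ (symmetricPullbackSpan A h : Set (Module.End ℂ (complexBetti A.X 1))))
    (ψ : X.prod A ⟶ X.prod A) :
    pullbackOne (X.prod A) ψ ∈ Algebra.adjoin ℂ
      (symmetricPullbackSpan (X.prod A) (prodPolarizationClass X A hX h) :
        Set (Module.End ℂ (complexBetti (X.prod A).X 1))) := by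
  have hHY : prodPolarizationClass X A hX h ∈ hodgeClassSpan (X.prod A).dim (X.prod A).X 1 :=
    prodPolarizationClass_mem_hodgeClassSpan _ _ hHX hh
  have hndY : ∀ x : complexBetti (X.prod A).X 1,
      (∀ y, polarizationPairingOne (X.prod A).X (prodPolarizationClass X A hX h) ((X.prod A).dim - 1) x y = 0) →
        x = 0 :=
    fun x hx ↦ eq_zero_of_forall_polarizationPairingOne_prod_eq_zero _ _ hX0 hA0 hXtop htop hndX hnd x hx
  set e : Module.End ℂ (complexBetti (X.prod A).X 1) :=
    pullbackOne (X.prod A) (AbelianVariety.fst X A ≫ AbelianVariety.prodLift (𝟙 X) (0 : X ⟶ A)) with he_def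
  have he : e ∈ symmetricPullbackSpan (X.prod A) (prodPolarizationClass X A hX h) :=
    projFst_mem_symmetricPullbackSpan_prod hX0 hA0
  have he2 : e * e = e := pullbackOne_fst_inl_mul_self
  have h1e : (1 : Module.End ℂ (complexBetti (X.prod A).X 1)) - e =
      pullbackOne (X.prod A) (AbelianVariety.snd X A ≫ AbelianVariety.prodLift (0 : A ⟶ X) (𝟙 A)) :=
    one_sub_pullbackOne_fst_inl
  have hψ : pullbackOne (X.prod A) ψ ∈
      Submodule.span ℂ (Set.range fun χ : X.prod A ⟶ X.prod A ↦ pullbackOne (X.prod A) χ) :=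
    Submodule.subset_span ⟨ψ, rfl⟩
  have split : pullbackOne (X.prod A) ψ = e * pullbackOne (X.prod A) ψ * e + e * pullbackOne (X.prod A) ψ * (1 - e) +
      (1 - e) * pullbackOne (X.prod A) ψ * e + (1 - e) * pullbackOne (X.prod A) ψ * (1 - e) := by
    simp only [mul_sub, sub_mul, mul_one, one_mul]
    abel
  rw [split]
  refine add_mem (add_mem (add_mem ?_ ?_) ?_) ?_
  · have eq : e * pullbackOne (X.prod A) ψ * e =
        prodBlockDiag (pullbackOne X (AbelianVariety.prodLift (𝟙 X) (0 : X ⟶ A) ≫ ψ ≫ AbelianVariety.fst X A))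
          (0 : Module.End ℂ (complexBetti A.X 1)) := by
      refine LinearMap.ext fun x ↦ ?_
      rw [prodBlockDiag_apply, LinearMap.zero_apply, map_zero, add_zero]
      simp only [Module.End.mul_apply, he_def, hom_apply'']
      rw [complexBetti_map_comp_apply, complexBetti_map_comp_apply, map_inl_map_map_fst_one]
    rw [eq]
    exact prodBlockDiag_zero_mem_adjoin_symmetricPullbackSpan_prod hX0 hA0 (hBX _)
  · exact mul_mul_one_sub_mem_adjoin_symmetricPullbackSpan hHY hndY he he2 hψ
  · exact one_sub_mul_mul_mem_adjoin_symmetricPullbackSpan hHY hndY he he2 hψ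
  · have eq : (1 - e) * pullbackOne (X.prod A) ψ * (1 - e) =
        prodBlockDiag (0 : Module.End ℂ (complexBetti X.X 1))
          (pullbackOne A (AbelianVariety.prodLift (0 : A ⟶ X) (𝟙 A) ≫ ψ ≫ AbelianVariety.snd X A)) := by
      rw [h1e]
      refine LinearMap.ext fun x ↦ ?_
      rw [prodBlockDiag_apply, LinearMap.zero_apply, map_zero, zero_add]
      simp only [Module.End.mul_apply, hom_apply'']
      rw [complexBetti_map_comp_apply, complexBetti_map_comp_apply, map_inr_map_map_snd_one]
    rw [eq]
    exact prodBlockDiag_zero_left_mem_adjoin_symmetricPullbackSpan_prod hX0 hA0 (hBA _)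

/-- **`B(X × A) ⊗ ℂ = End⁰(X × A) ⊗ ℂ` from the two factors** (as subspaces of `End_ℂ H¹((X × A)(ℂ); ℂ)`).
[cite: MoonenZarhin1998WeilClasses, §1 (chunk p0002 L56–58, L96–97; chunk p0003 «B = Mat_m(D)»)] [cite: Milne1999LefschetzClasses, §1 p. 643 and Remark 1.2] -/
theorem adjoin_symmetricPullbackSpan_prod_eq_span_of_forall (hX0 : 0 < X.dim) (hA0 : 0 < A.dim)
    (hHX : hX ∈ hodgeClassSpan X.dim X.X 1) (hh : h ∈ hodgeClassSpan A.dim A.X 1)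
    (hndX : ∀ x : complexBetti X.X 1, (∀ y, polarizationPairingOne X.X hX (X.dim - 1) x y = 0) → x = 0)
    (hnd : ∀ x : complexBetti A.X 1, (∀ y, polarizationPairingOne A.X h (A.dim - 1) x y = 0) → x = 0)
    (hXtop : lefschetzPow hX (X.dim - 1) 2 hX ≠ 0) (htop : lefschetzPow h (A.dim - 1) 2 h ≠ 0)
    (hBX : ∀ φ : X ⟶ X, pullbackOne X φ ∈
      Algebra.adjoin ℂ (symmetricPullbackSpan X hX : Set (Module.End ℂ (complexBetti X.X 1))))
    (hBA : ∀ φ : A ⟶ A, pullbackOne A φ ∈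
      Algebra.adjoin ℂ (symmetricPullbackSpan A h : Set (Module.End ℂ (complexBetti A.X 1)))) :
    Subalgebra.toSubmodule (Algebra.adjoin ℂ
        (symmetricPullbackSpan (X.prod A) (prodPolarizationClass X A hX h) :
          Set (Module.End ℂ (complexBetti (X.prod A).X 1)))) =
      Submodule.span ℂ (Set.range fun ψ : X.prod A ⟶ X.prod A ↦ pullbackOne (X.prod A) ψ) := by
  refine le_antisymm (adjoin_symmetricPullbackSpan_le_span _) (Submodule.span_le.2 ?_)
  rintro _ ⟨ψ, rfl⟩
  exact pullbackOne_prod_mem_adjoin_symmetricPullbackSpan_of_forall hX0 hA0 hHX hh hndX hnd hXtop htop hBX hBA ψ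

/-- **`G_div(X × A)(pr_X^* h_X + pr_A^* h) = S(X × A)` from the two factors.**
[cite: MoonenZarhin1998WeilClasses, §1 (chunk p0002 L66–71, L96–97)] [cite: Milne1999LefschetzClasses, §1 pp. 643–644] -/
theorem divisorLefschetzGroup_prod_eq_unitaryCentralizerGroup_of_forall (hX0 : 0 < X.dim) (hA0 : 0 < A.dim)
    (hHX : hX ∈ hodgeClassSpan X.dim X.X 1) (hh : h ∈ hodgeClassSpan A.dim A.X 1)
    (hndX : ∀ x : complexBetti X.X 1, (∀ y, polarizationPairingOne X.X hX (X.dim - 1) x y = 0) → x = 0)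
    (hnd : ∀ x : complexBetti A.X 1, (∀ y, polarizationPairingOne A.X h (A.dim - 1) x y = 0) → x = 0)
    (hXtop : lefschetzPow hX (X.dim - 1) 2 hX ≠ 0) (htop : lefschetzPow h (A.dim - 1) 2 h ≠ 0)
    (hBX : ∀ φ : X ⟶ X, pullbackOne X φ ∈
      Algebra.adjoin ℂ (symmetricPullbackSpan X hX : Set (Module.End ℂ (complexBetti X.X 1))))
    (hBA : ∀ φ : A ⟶ A, pullbackOne A φ ∈
      Algebra.adjoin ℂ (symmetricPullbackSpan A h : Set (Module.End ℂ (complexBetti A.X 1)))) :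
    divisorLefschetzGroup (X.prod A) (prodPolarizationClass X A hX h) =
      unitaryCentralizerGroup (X.prod A) (prodPolarizationClass X A hX h) :=
  divisorLefschetzGroup_eq_unitaryCentralizerGroup_of_forall_mem_adjoin
    (pullbackOne_prod_mem_adjoin_symmetricPullbackSpan_of_forall hX0 hA0 hHX hh hndX hnd hXtop htop hBX hBA)

/-- **… and for EVERY class `H' ∈ B¹(X × A) ⊗ ℂ` with `Q_{H'}` non-degenerate** («`G_div(X)` does not depend on
the choice of `λ`», the seat's `adjoin_symmetricPullbackSpan_eq_of_mem_hodgeClassSpan`): every `ψ^*` lies in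
`B(X × A)(H') ⊗ ℂ`, and `G_div(X × A)(H') = S(X × A)(H')`. [cite: MoonenZarhin1998WeilClasses, §1 (chunk p0002 L59–61, L83, L96–97)]
[cite: Milne1999LefschetzClasses, §1 pp. 643–644] -/
theorem divisorLefschetzGroup_prod_eq_unitaryCentralizerGroup_of_forall' (hX0 : 0 < X.dim) (hA0 : 0 < A.dim)
    (hHX : hX ∈ hodgeClassSpan X.dim X.X 1) (hh : h ∈ hodgeClassSpan A.dim A.X 1)
    (hndX : ∀ x : complexBetti X.X 1, (∀ y, polarizationPairingOne X.X hX (X.dim - 1) x y = 0) → x = 0)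
    (hnd : ∀ x : complexBetti A.X 1, (∀ y, polarizationPairingOne A.X h (A.dim - 1) x y = 0) → x = 0)
    (hXtop : lefschetzPow hX (X.dim - 1) 2 hX ≠ 0) (htop : lefschetzPow h (A.dim - 1) 2 h ≠ 0)
    (hBX : ∀ φ : X ⟶ X, pullbackOne X φ ∈
      Algebra.adjoin ℂ (symmetricPullbackSpan X hX : Set (Module.End ℂ (complexBetti X.X 1))))
    (hBA : ∀ φ : A ⟶ A, pullbackOne A φ ∈
      Algebra.adjoin ℂ (symmetricPullbackSpan A h : Set (Module.End ℂ (complexBetti A.X 1))))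
    {H' : complexBetti (X.prod A).X 2} (hH' : H' ∈ hodgeClassSpan (X.prod A).dim (X.prod A).X 1)
    (hndH' : ∀ x : complexBetti (X.prod A).X 1,
      (∀ y, polarizationPairingOne (X.prod A).X H' ((X.prod A).dim - 1) x y = 0) → x = 0) :
    divisorLefschetzGroup (X.prod A) H' = unitaryCentralizerGroup (X.prod A) H' := by
  refine divisorLefschetzGroup_eq_unitaryCentralizerGroup_of_forall_mem_adjoin fun ψ ↦ ?_
  rw [adjoin_symmetricPullbackSpan_eq_of_mem_hodgeClassSpan hH' hndH'
    (prodPolarizationClass_mem_hodgeClassSpan _ _ hHX hh)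
    (fun x hx ↦ eq_zero_of_forall_polarizationPairingOne_prod_eq_zero _ _ hX0 hA0 hXtop htop hndX hnd x hx)]
  exact pullbackOne_prod_mem_adjoin_symmetricPullbackSpan_of_forall hX0 hA0 hHX hh hndX hnd hXtop htop hBX hBA ψ

end Prod

/-! ## Chapter III, Part 3. Two isotypic blocks with multiplicities `≥ 2`: `X ∼ A₁^{a+2}`, `X' ∼ A₂^{b+2}` -/

section TwoBlocks

variable {X X' A₁ A₂ : AbelianVariety ℂ} {h₁ : complexBetti A₁.X 2} {h₂ : complexBetti A₂.X 2}
  {hX : complexBetti X.X 2} {hX' : complexBetti X'.X 2}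

/-- **Moonen–Zarhin's decomposition `X ∼ Y₁^{m₁} × ⋯ × Y_k^{m_k}` with all `mᵢ ≥ 2`, two blocks, on the carrier**:
for `X ∼ A₁^{a+2}` and `X' ∼ A₂^{b+2}` (`Aᵢ` of positive dimension with classes `hᵢ ∈ B¹ ⊗ ℂ`, non-degenerate
pairings, non-zero top powers — no hypothesis relating `A₁` and `A₂`), classes `h_X`, `h_{X'}` on the blocks with
the same three properties, and EVERY class `H' ∈ B¹(X × X') ⊗ ℂ` with `Q_{H'}` non-degenerate:
`G_div(X × X')(H') = S(X × X')(H')`. [cite: MoonenZarhin1998WeilClasses, §1 (chunk p0002 L1–5, L45–46, L96–97; chunk p0003 «B = Mat_m(D)»)]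
[cite: Milne1999LefschetzClasses, §1 pp. 643–644] -/
theorem divisorLefschetzGroup_prod_eq_unitaryCentralizerGroup_of_isIsogenous_powSucc
    (hA₁ : 0 < A₁.dim) (hh₁ : h₁ ∈ hodgeClassSpan A₁.dim A₁.X 1)
    (hnd₁ : ∀ x : complexBetti A₁.X 1, (∀ y, polarizationPairingOne A₁.X h₁ (A₁.dim - 1) x y = 0) → x = 0)
    (htop₁ : lefschetzPow h₁ (A₁.dim - 1) 2 h₁ ≠ 0)
    (hA₂ : 0 < A₂.dim) (hh₂ : h₂ ∈ hodgeClassSpan A₂.dim A₂.X 1)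
    (hnd₂ : ∀ x : complexBetti A₂.X 1, (∀ y, polarizationPairingOne A₂.X h₂ (A₂.dim - 1) x y = 0) → x = 0)
    (htop₂ : lefschetzPow h₂ (A₂.dim - 1) 2 h₂ ≠ 0)
    {a b : ℕ} (hXA : AbelianVariety.IsIsogenous X (A₁.powSucc (a + 1)))
    (hX'A : AbelianVariety.IsIsogenous X' (A₂.powSucc (b + 1)))
    (hX0 : 0 < X.dim) (hX'0 : 0 < X'.dim)
    (hhX : hX ∈ hodgeClassSpan X.dim X.X 1) (hhX' : hX' ∈ hodgeClassSpan X'.dim X'.X 1)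
    (hndX : ∀ x : complexBetti X.X 1, (∀ y, polarizationPairingOne X.X hX (X.dim - 1) x y = 0) → x = 0)
    (hndX' : ∀ x : complexBetti X'.X 1, (∀ y, polarizationPairingOne X'.X hX' (X'.dim - 1) x y = 0) → x = 0)
    (hXtop : lefschetzPow hX (X.dim - 1) 2 hX ≠ 0) (hX'top : lefschetzPow hX' (X'.dim - 1) 2 hX' ≠ 0)
    {H' : complexBetti (X.prod X').X 2} (hH' : H' ∈ hodgeClassSpan (X.prod X').dim (X.prod X').X 1)
    (hndH' : ∀ x : complexBetti (X.prod X').X 1,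
      (∀ y, polarizationPairingOne (X.prod X').X H' ((X.prod X').dim - 1) x y = 0) → x = 0) :
    divisorLefschetzGroup (X.prod X') H' = unitaryCentralizerGroup (X.prod X') H' :=
  divisorLefschetzGroup_prod_eq_unitaryCentralizerGroup_of_forall' hX0 hX'0 hhX hhX' hndX hndX' hXtop hX'top
    (pullbackOne_mem_adjoin_symmetricPullbackSpan_of_isIsogenous_powSucc hA₁ hh₁ hnd₁ htop₁ hXA hhX hndX)
    (pullbackOne_mem_adjoin_symmetricPullbackSpan_of_isIsogenous_powSucc hA₂ hh₂ hnd₂ htop₂ hX'A hhX' hndX')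
    hH' hndH'

end TwoBlocks

/-! ## Chapter III, Part 4. Any number of blocks: finite biproducts `⨁ᵢ Aᵢ`, and `X ∼ ⨁ᵢ Yᵢ^{mᵢ+2}` -/

section Biproduct

open CategoryTheory.Limits

/-- **«`Δ = D`» for a finite biproduct from its factors**: if every factor `Aᵢ` (`i < n + 1`, `0 < dim Aᵢ`,
`hᵢ ∈ B¹(Aᵢ) ⊗ ℂ` with `hᵢ^{dim Aᵢ} ≠ 0` and `Q_{hᵢ}` non-degenerate) has every pull-back in `B(Aᵢ)(hᵢ) ⊗ ℂ`, then
every pull-back `ψ^*`, `ψ ∈ End(⨁ᵢ Aᵢ)`, lies in `B(⨁ᵢ Aᵢ)(Σᵢ πᵢ^* hᵢ) ⊗ ℂ` (Milne's product divisor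
`D = Σᵢ A₁ × ⋯ × Dᵢ × ⋯ × A_s`, the lane's `sumPolarizationClass`) — induction along
`⨁_{Fin (n+1)} A ≅ A 0 × ⨁_{Fin n} (A ∘ succ)` (the lane's `biproductSuccSplit`, an isogeny) with Part 2 and the
transport of Chapter I. [cite: MoonenZarhin1998WeilClasses, §1 (chunk p0002 L1–5, L96–97; chunk p0003 «B = Mat_m(D)»)]
[cite: Milne1999LefschetzClasses, §1 p. 643] -/
theorem pullbackOne_biproduct_mem_adjoin_symmetricPullbackSpan : ∀ {n : ℕ} (A : Fin (n + 1) → AbelianVariety ℂ)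
    (h : ∀ i, complexBetti (A i).X 2), (∀ i, 0 < (A i).dim) →
    (∀ i, h i ∈ hodgeClassSpan (A i).dim (A i).X 1) →
    (∀ i, lefschetzPow (h i) ((A i).dim - 1) 2 (h i) ≠ 0) →
    (∀ (i) (x : complexBetti (A i).X 1),
      (∀ y, polarizationPairingOne (A i).X (h i) ((A i).dim - 1) x y = 0) → x = 0) →
    (∀ (i) (φ : A i ⟶ A i), pullbackOne (A i) φ ∈
      Algebra.adjoin ℂ (symmetricPullbackSpan (A i) (h i) : Set (Module.End ℂ (complexBetti (A i).X 1)))) →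
    ∀ ψ : (⨁ A) ⟶ ⨁ A, pullbackOne (⨁ A) ψ ∈
      Algebra.adjoin ℂ (symmetricPullbackSpan (⨁ A) (sumPolarizationClass A h) :
        Set (Module.End ℂ (complexBetti (⨁ A).X 1)))
  | 0, A, h, _, _, _, _, hB, ψ => by
    rw [sumPolarizationClass_fin_one]
    exact forall_pullbackOne_mem_adjoin_symmetricPullbackSpan_of_isIsogeny (isIsogeny_biproduct_π_fin_one A) (h 0)
      (hB 0) ψ
  | n + 1, A, h, h0, hh, htop, hnd, hB, ψ => by
    obtain ⟨hh', htop', hnd'⟩ := sumPolarizationClass_hypotheses (fun i : Fin (n + 1) => A i.succ)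
      (fun i => h i.succ) (fun i => h0 _) (fun i => hh _) (fun i => htop _) (fun i => hnd _)
    have hB0 : 0 < (A 0).dim := h0 0
    have hC0 : 0 < (⨁ fun i : Fin (n + 1) => A i.succ).dim := dim_biproduct_pos _ (h0 _)
    have IH := pullbackOne_biproduct_mem_adjoin_symmetricPullbackSpan (fun i : Fin (n + 1) => A i.succ)
      (fun i => h i.succ) (fun i => h0 _) (fun i => hh _) (fun i => htop _) (fun i => hnd _) (fun i φ => hB _ φ)
    have H := forall_pullbackOne_mem_adjoin_symmetricPullbackSpan_of_isIsogeny (isIsogeny_biproductSuccSplit A) _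
      (pullbackOne_prod_mem_adjoin_symmetricPullbackSpan_of_forall hB0 hC0 (hh 0) hh' (hnd 0) hnd' (htop 0) htop'
        (hB 0) IH) ψ
    rwa [map_biproductSuccSplit_prodPolarizationClass] at H

/-- **`G_div(⨁ᵢ Aᵢ)(Σᵢ πᵢ^* hᵢ) = S(⨁ᵢ Aᵢ)`** from the factors. [cite: MoonenZarhin1998WeilClasses, §1 (chunk p0002 L1–5, L66–71, L96–97)]
[cite: Milne1999LefschetzClasses, §1 pp. 643–644] -/
theorem divisorLefschetzGroup_biproduct_eq_unitaryCentralizerGroup {n : ℕ} (A : Fin (n + 1) → AbelianVariety ℂ)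
    (h : ∀ i, complexBetti (A i).X 2) (h0 : ∀ i, 0 < (A i).dim)
    (hh : ∀ i, h i ∈ hodgeClassSpan (A i).dim (A i).X 1)
    (htop : ∀ i, lefschetzPow (h i) ((A i).dim - 1) 2 (h i) ≠ 0)
    (hnd : ∀ (i) (x : complexBetti (A i).X 1),
      (∀ y, polarizationPairingOne (A i).X (h i) ((A i).dim - 1) x y = 0) → x = 0)
    (hB : ∀ (i) (φ : A i ⟶ A i), pullbackOne (A i) φ ∈
      Algebra.adjoin ℂ (symmetricPullbackSpan (A i) (h i) : Set (Module.End ℂ (complexBetti (A i).X 1)))) :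
    divisorLefschetzGroup (⨁ A) (sumPolarizationClass A h) = unitaryCentralizerGroup (⨁ A) (sumPolarizationClass A h) :=
  divisorLefschetzGroup_eq_unitaryCentralizerGroup_of_forall_mem_adjoin
    (pullbackOne_biproduct_mem_adjoin_symmetricPullbackSpan A h h0 hh htop hnd hB)

/-- **Up to isogeny and for every polarization class**: for `X ∼ ⨁ᵢ Aᵢ` (factors as above) and every
`h_X ∈ B¹(X) ⊗ ℂ` with `Q_{h_X}` non-degenerate, every `ψ^*`, `ψ ∈ End(X)`, lies in `B(X)(h_X) ⊗ ℂ`.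
[cite: MoonenZarhin1998WeilClasses, §1 (chunk p0002 L1–5, L45–46, L83, L96–97)] [cite: Milne1999LefschetzClasses, §1 pp. 643–644] -/
theorem pullbackOne_mem_adjoin_symmetricPullbackSpan_of_isIsogenous_biproduct {n : ℕ}
    (A : Fin (n + 1) → AbelianVariety ℂ) (h : ∀ i, complexBetti (A i).X 2) (h0 : ∀ i, 0 < (A i).dim)
    (hh : ∀ i, h i ∈ hodgeClassSpan (A i).dim (A i).X 1)
    (htop : ∀ i, lefschetzPow (h i) ((A i).dim - 1) 2 (h i) ≠ 0)
    (hnd : ∀ (i) (x : complexBetti (A i).X 1),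
      (∀ y, polarizationPairingOne (A i).X (h i) ((A i).dim - 1) x y = 0) → x = 0)
    (hB : ∀ (i) (φ : A i ⟶ A i), pullbackOne (A i) φ ∈
      Algebra.adjoin ℂ (symmetricPullbackSpan (A i) (h i) : Set (Module.End ℂ (complexBetti (A i).X 1))))
    {X : AbelianVariety ℂ} (hXA : AbelianVariety.IsIsogenous X (⨁ A)) {hX : complexBetti X.X 2}
    (hhX : hX ∈ hodgeClassSpan X.dim X.X 1)
    (hndX : ∀ x : complexBetti X.X 1, (∀ y, polarizationPairingOne X.X hX (X.dim - 1) x y = 0) → x = 0)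
    (ψ : X ⟶ X) :
    pullbackOne X ψ ∈ Algebra.adjoin ℂ (symmetricPullbackSpan X hX : Set (Module.End ℂ (complexBetti X.X 1))) := by
  obtain ⟨f, hf⟩ := hXA
  obtain ⟨hH, hHtop, hHnd⟩ := sumPolarizationClass_hypotheses A h h0 hh htop hnd
  obtain ⟨hfH, -, hndfH⟩ := polarization_hypotheses_map hf hH hHtop hHnd
  rw [adjoin_symmetricPullbackSpan_eq_of_mem_hodgeClassSpan hhX hndX hfH hndfH]
  exact forall_pullbackOne_mem_adjoin_symmetricPullbackSpan_of_isIsogeny hf _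
    (pullbackOne_biproduct_mem_adjoin_symmetricPullbackSpan A h h0 hh htop hnd hB) ψ

/-- **Moonen–Zarhin's decomposition `X ∼ Y₁^{m₁} × ⋯ × Y_k^{m_k}` with ALL `mᵢ ≥ 2`, on the carrier: `G_div(X) = S(X)`
for every polarization class.** For complex abelian varieties `Yᵢ` (`i < k`, `k = n + 1`) of positive dimension with
classes `hᵢ ∈ B¹(Yᵢ) ⊗ ℂ` (`hᵢ^{dim Yᵢ} ≠ 0`, `Q_{hᵢ}` non-degenerate), exponents `mᵢ = aᵢ + 2`, every `X` isogenous to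
`⨁ᵢ Yᵢ^{aᵢ+2}` and every `h_X ∈ B¹(X) ⊗ ℂ` with `Q_{h_X}` non-degenerate: Moonen–Zarhin's `G_div(X)(h_X)(ℂ)` is Milne's
`S(X)(h_X)(ℂ)` (each block has «`Δ = D`» by the seat's `DivisorAlgebraPowers`; blocks assemble by Part 4; isogeny and
polarization by Chapter I). No hypothesis relating the `Yᵢ` (simplicity, non-isogeny) is used.
[cite: MoonenZarhin1998WeilClasses, §1 (chunk p0002 L1–5, L45–46, L83–85, L92–97; chunk p0003 «B = Mat_m(D)»)]
[cite: Milne1999LefschetzClasses, §1 pp. 643–644] -/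
theorem divisorLefschetzGroup_eq_unitaryCentralizerGroup_of_isIsogenous_biproduct_powSucc {n : ℕ}
    (Y : Fin (n + 1) → AbelianVariety ℂ) (h : ∀ i, complexBetti (Y i).X 2) (a : Fin (n + 1) → ℕ)
    (h0 : ∀ i, 0 < (Y i).dim) (hh : ∀ i, h i ∈ hodgeClassSpan (Y i).dim (Y i).X 1)
    (htop : ∀ i, lefschetzPow (h i) ((Y i).dim - 1) 2 (h i) ≠ 0)
    (hnd : ∀ (i) (x : complexBetti (Y i).X 1),
      (∀ y, polarizationPairingOne (Y i).X (h i) ((Y i).dim - 1) x y = 0) → x = 0)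
    {X : AbelianVariety ℂ} (hXY : AbelianVariety.IsIsogenous X (⨁ fun i => (Y i).powSucc (a i + 1)))
    {hX : complexBetti X.X 2} (hhX : hX ∈ hodgeClassSpan X.dim X.X 1)
    (hndX : ∀ x : complexBetti X.X 1, (∀ y, polarizationPairingOne X.X hX (X.dim - 1) x y = 0) → x = 0) :
    divisorLefschetzGroup X hX = unitaryCentralizerGroup X hX :=
  divisorLefschetzGroup_eq_unitaryCentralizerGroup_of_forall_mem_adjoin
    (pullbackOne_mem_adjoin_symmetricPullbackSpan_of_isIsogenous_biproduct (fun i => (Y i).powSucc (a i + 1))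
      (fun i => powPolarizationClass (Y i) (h i) (a i + 1)) (fun i => dim_powSucc_pos (h0 i) _)
      (fun i => powPolarizationClass_mem_hodgeClassSpan (hh i) _)
      (fun i => lefschetzPow_powPolarizationClass_self_ne_zero (h0 i) (htop i) _)
      (fun i => eq_zero_of_forall_polarizationPairingOne_powPolarizationClass_eq_zero (h0 i) (htop i) (hnd i) _)
      (fun i φ => pullbackOne_powSucc_mem_adjoin_symmetricPullbackSpan (h0 i) (hh i) (hnd i) (htop i) _ φ)
      hXY hhX hndX)

/-- **«`B = Mat_m(D)`» ⊗ ℂ for `X ∼ ⨁ᵢ Yᵢ^{aᵢ+2}` and every admissible class: `B(X)(h_X) ⊗ ℂ = End⁰(X) ⊗ ℂ`**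
(as subspaces of `End_ℂ H¹(X(ℂ); ℂ)`). [cite: MoonenZarhin1998WeilClasses, §1 (chunk p0002 L1–5, L45–46, L96–97; chunk p0003 «B = Mat_m(D)»)]
[cite: Milne1999LefschetzClasses, §1 p. 643 and Remark 1.2] -/
theorem adjoin_symmetricPullbackSpan_eq_span_of_isIsogenous_biproduct_powSucc {n : ℕ}
    (Y : Fin (n + 1) → AbelianVariety ℂ) (h : ∀ i, complexBetti (Y i).X 2) (a : Fin (n + 1) → ℕ)
    (h0 : ∀ i, 0 < (Y i).dim) (hh : ∀ i, h i ∈ hodgeClassSpan (Y i).dim (Y i).X 1)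
    (htop : ∀ i, lefschetzPow (h i) ((Y i).dim - 1) 2 (h i) ≠ 0)
    (hnd : ∀ (i) (x : complexBetti (Y i).X 1),
      (∀ y, polarizationPairingOne (Y i).X (h i) ((Y i).dim - 1) x y = 0) → x = 0)
    {X : AbelianVariety ℂ} (hXY : AbelianVariety.IsIsogenous X (⨁ fun i => (Y i).powSucc (a i + 1)))
    {hX : complexBetti X.X 2} (hhX : hX ∈ hodgeClassSpan X.dim X.X 1)
    (hndX : ∀ x : complexBetti X.X 1, (∀ y, polarizationPairingOne X.X hX (X.dim - 1) x y = 0) → x = 0) :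
    Subalgebra.toSubmodule (Algebra.adjoin ℂ
        (symmetricPullbackSpan X hX : Set (Module.End ℂ (complexBetti X.X 1)))) =
      Submodule.span ℂ (Set.range fun ψ : X ⟶ X ↦ pullbackOne X ψ) := by
  refine le_antisymm (adjoin_symmetricPullbackSpan_le_span hX) (Submodule.span_le.2 ?_)
  rintro _ ⟨ψ, rfl⟩
  exact pullbackOne_mem_adjoin_symmetricPullbackSpan_of_isIsogenous_biproduct (fun i => (Y i).powSucc (a i + 1))
    (fun i => powPolarizationClass (Y i) (h i) (a i + 1)) (fun i => dim_powSucc_pos (h0 i) _)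
    (fun i => powPolarizationClass_mem_hodgeClassSpan (hh i) _)
    (fun i => lefschetzPow_powPolarizationClass_self_ne_zero (h0 i) (htop i) _)
    (fun i => eq_zero_of_forall_polarizationPairingOne_powPolarizationClass_eq_zero (h0 i) (htop i) (hnd i) _)
    (fun i φ => pullbackOne_powSucc_mem_adjoin_symmetricPullbackSpan (h0 i) (hh i) (hnd i) (htop i) _ φ)
    hXY hhX hndX ψ

/-- **Lemma (3), first clause, «`End(V_X)^{G_div(X)} = B`» ⊗ ℂ for `X ∼ ⨁ᵢ Yᵢ^{aᵢ+2}` and every admissible class**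
(the Chapter II mechanism fed with Part 4). [cite: MoonenZarhin1998WeilClasses, §1 Lemma (3) (chunk p0003 L5–6) and «Δ = D» (chunk p0002 L96–97)]
[cite: Deligne1982HodgeCycles, I §3 Prop. 3.4] -/
theorem forall_mem_divisorLefschetzGroup_comm_iff_mem_adjoin_of_isIsogenous_biproduct_powSucc {n : ℕ}
    (Y : Fin (n + 1) → AbelianVariety ℂ) (h : ∀ i, complexBetti (Y i).X 2) (a : Fin (n + 1) → ℕ)
    (h0 : ∀ i, 0 < (Y i).dim) (hh : ∀ i, h i ∈ hodgeClassSpan (Y i).dim (Y i).X 1)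
    (htop : ∀ i, lefschetzPow (h i) ((Y i).dim - 1) 2 (h i) ≠ 0)
    (hnd : ∀ (i) (x : complexBetti (Y i).X 1),
      (∀ y, polarizationPairingOne (Y i).X (h i) ((Y i).dim - 1) x y = 0) → x = 0)
    {X : AbelianVariety ℂ} (hXY : AbelianVariety.IsIsogenous X (⨁ fun i => (Y i).powSucc (a i + 1)))
    {hX : complexBetti X.X 2} (hhX : hX ∈ hodgeClassSpan X.dim X.X 1)
    (hndX : ∀ x : complexBetti X.X 1, (∀ y, polarizationPairingOne X.X hX (X.dim - 1) x y = 0) → x = 0)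
    {T : Module.End ℂ (complexBetti X.X 1)} :
    (∀ u ∈ divisorLefschetzGroup X hX, ∀ y : complexBetti X.X 1, T (u y) = u (T y)) ↔
      T ∈ Algebra.adjoin ℂ (symmetricPullbackSpan X hX : Set (Module.End ℂ (complexBetti X.X 1))) :=
  forall_mem_divisorLefschetzGroup_comm_iff_mem_adjoin hhX
    (pullbackOne_mem_adjoin_symmetricPullbackSpan_of_isIsogenous_biproduct (fun i => (Y i).powSucc (a i + 1))
      (fun i => powPolarizationClass (Y i) (h i) (a i + 1)) (fun i => dim_powSucc_pos (h0 i) _)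
      (fun i => powPolarizationClass_mem_hodgeClassSpan (hh i) _)
      (fun i => lefschetzPow_powPolarizationClass_self_ne_zero (h0 i) (htop i) _)
      (fun i => eq_zero_of_forall_polarizationPairingOne_powPolarizationClass_eq_zero (h0 i) (htop i) (hnd i) _)
      (fun i φ => pullbackOne_powSucc_mem_adjoin_symmetricPullbackSpan (h0 i) (hh i) (hnd i) (htop i) _ φ)
      hXY hhX hndX)

/-- **Lemma (1) «the center of `G_div(X)` is `U_{K_B}`», `ℂ`-points, for `X ∼ ⨁ᵢ Yᵢ^{aᵢ+2}` and every admissible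
class**: an element of `G_div(X)(h_X)(ℂ)` is central iff it lies in `B ⊗ ℂ` (`= End⁰(X) ⊗ ℂ`).
[cite: MoonenZarhin1998WeilClasses, §1 Lemma (1) (chunk p0002 L121–124) and «Δ = D» (L96–97)] [cite: Deligne1982HodgeCycles, I §3 Prop. 3.4] -/
theorem mem_center_divisorLefschetzGroup_iff_coe_mem_adjoin_of_isIsogenous_biproduct_powSucc {n : ℕ}
    (Y : Fin (n + 1) → AbelianVariety ℂ) (h : ∀ i, complexBetti (Y i).X 2) (a : Fin (n + 1) → ℕ)
    (h0 : ∀ i, 0 < (Y i).dim) (hh : ∀ i, h i ∈ hodgeClassSpan (Y i).dim (Y i).X 1)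
    (htop : ∀ i, lefschetzPow (h i) ((Y i).dim - 1) 2 (h i) ≠ 0)
    (hnd : ∀ (i) (x : complexBetti (Y i).X 1),
      (∀ y, polarizationPairingOne (Y i).X (h i) ((Y i).dim - 1) x y = 0) → x = 0)
    {X : AbelianVariety ℂ} (hXY : AbelianVariety.IsIsogenous X (⨁ fun i => (Y i).powSucc (a i + 1)))
    {hX : complexBetti X.X 2} (hhX : hX ∈ hodgeClassSpan X.dim X.X 1)
    (hndX : ∀ x : complexBetti X.X 1, (∀ y, polarizationPairingOne X.X hX (X.dim - 1) x y = 0) → x = 0)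
    {z : divisorLefschetzGroup X hX} :
    z ∈ Subgroup.center (divisorLefschetzGroup X hX) ↔
      ((z : complexBetti X.X 1 ≃ₗ[ℂ] complexBetti X.X 1) : Module.End ℂ (complexBetti X.X 1)) ∈
        Algebra.adjoin ℂ (symmetricPullbackSpan X hX : Set (Module.End ℂ (complexBetti X.X 1))) :=
  mem_center_divisorLefschetzGroup_iff_coe_mem_adjoin hhX
    (pullbackOne_mem_adjoin_symmetricPullbackSpan_of_isIsogenous_biproduct (fun i => (Y i).powSucc (a i + 1))
      (fun i => powPolarizationClass (Y i) (h i) (a i + 1)) (fun i => dim_powSucc_pos (h0 i) _)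
      (fun i => powPolarizationClass_mem_hodgeClassSpan (hh i) _)
      (fun i => lefschetzPow_powPolarizationClass_self_ne_zero (h0 i) (htop i) _)
      (fun i => eq_zero_of_forall_polarizationPairingOne_powPolarizationClass_eq_zero (h0 i) (htop i) (hnd i) _)
      (fun i φ => pullbackOne_powSucc_mem_adjoin_symmetricPullbackSpan (h0 i) (hh i) (hnd i) (htop i) _ φ)
      hXY hhX hndX)

end Biproduct

end Literature.AlgebraicGeometry.HodgeTheory

end
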